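import Summits.QuantumFields.YangMills.Theses.ConvexGribovBody
import Summits.QuantumFields.YangMills.Theorems.ConvexGribovBodyNonSimplyConnectedLatticeGapStubSectorIdentity
import Summits.QuantumFields.YangMills.Theorems.ConvexGribovBodyNonSimplyConnectedLatticeGapStubCorrPullbackCover
import Summits.QuantumFields.YangMills.Theorems.ConvexGribovBodyNonSimplyConnectedLatticeGapStubTwistPlaneExchange
import Summits.QuantumFields.YangMills.Theorems.ConvexGribovBodyNonSimplyConnectedLatticeGapAdmissibleInstance
import Summits.QuantumFields.YangMills.Theorems.ConvexGribovBodyNonSimplyConnectedLatticeGapStubSectorMixture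
import Summits.QuantumFields.YangMills.Theorems.ConvexGribovBodyNonSimplyConnectedLatticeGapTorusBadEventRare
import Summits.QuantumFields.YangMills.Theorems.ConvexGribovBodyNonSimplyConnectedLatticeGapStubUniversalCoverAux1
import Summits.QuantumFields.YangMills.Theorems.ConvexGribovBodyNonSimplyConnectedLatticeGapUniversalCoverSO3
import Literature.MathematicalPhysics.QuantumFieldTheory.LatticeGaugeStaticPotentialProofs
import Literature.AlgebraicTopology.FundamentalGroup.RotationGroupSO3
import Literature.MathematicalPhysics.QuantumLattice.GaugeGroups
import Literature.RepresentationTheory.CompactGroups.CompactSemisimpleUniversalCover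
import HarnessLib

/-!
# Skeleton line `twist-equipartition-blindness` (v2) for crux `NonSimplyConnectedLatticeGap`
# (stmt-QuantumFields-16405), route `QuantumFields/YangMills/ConvexGribovBody`

v1: planner `planner-cruxplan-stmt-QuantumFields-16405-twist-equipartition--0`, 2026-08-17 (7 stubs). v2: lead
`prover-line-stmt-QuantumFields-16405-a1-0`, 2026-08-17, after wave 1 — WHAT CHANGED: (i) MIX is no longer a stub:
`stub_sectorMixture` LANDED (p165422 + Aux p164497/p164608/p164823) and its v2 shape is PROVED here from the landed
core (`sectorMixture_of_core`); (ii) STRUCT's rarity half LANDED cls-free (`torusBadEventRare` p164029), the stub is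
now existence-only (`stub_sectorLabelling`); (iii) EQUI RESHAPED (wave-1 audit, stub-misstated): equipartition is
asked only for tori `S ≥ S_e`, `S_e` after `β` — at small badness `a` the smallest tori can have EMPTY electric
sectors (no clean representative of a Pfaffian-odd twist; sup-plaquette action of torons `≈ c_r (2S+1)⁻⁴`) next to
non-empty commutator-pattern sectors (twist eaters, p164453 `plaquetteHolonomy_twistEater`), so no `S`-uniform
multiplicative comparability can hold; the EquiAt hypothesis of MIX/EBLIND/PSC changed accordingly; (iv) COVER is
reduced (LANDED `stub_universalCover_of_cover` p164142; instance SO(3) LANDED p163818) to the published Weyl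
covering theorem over Mathlib vocabulary (`stub_weylCovering`); (v) EBLIND's abstract operator step (III) LANDED
(`centreFourier_traceBlindness` p164278); SPLIT numerically confirmed for SU(2)→SO(3) (all r), Sp(2)→SO(5),
SU(4)→SO(6), Spin(7)→SO(7), SU(3)→PSU(3) with a new elementary closed form of the Bessel cell
(`½ e^{β((tr h)² − 1)}(1 + erf(√β tr h))`, positive type by nonnegative Taylor coefficients). Six stubs remain:
WEYL, STRUCT-EXIST, EQUI, SPLIT, EBLIND, PSC. Idea card
`Cruxes/NonSimplyConnectedLatticeGap/Ideas/twist-equipartition-blindness.md` (+ triage sharpenings S1–S3 of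
`TRIAGE-r1-1.md`, `TRIAGE-r1-2.md`); line card `Lines/twist-equipartition-blindness.md`.

THE LINE. The periodic `(G, r)` Wilson theory of a compact simple `G` with `π₁(G) ≠ 0` IS the `(H, r∘π)` theory of
its universal cover `π : H → G` (finite central kernel `ker π ≅ π₁(G)`; COVER = Weyl's theorem + the landed pullback
`stub_corrPullbackCover`) on pulled-back observables. On the
`H`-side the configuration space splits, off an exponentially rare bad event, into the `|ker π|⁶` sectors of the
monopole-corrected 't Hooft class `z ∈ H²(T⁴; ker π)` (STRUCT). The exact law of total covariance (landed
`stub_sectorIdentity`) shows that volume-uniform clustering needs exactly two things — clustering INSIDE each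
sector (PSC) and exponential BLINDNESS of local observables to the sector — and the symmetric torus `(2S+1)⁴`
makes every magnetic slot electric after an axis permutation (MIX, using the landed `wilsonMeasure_map_configPerm`
/ `stub_twistPlaneExchange` mechanism), so blindness is an ELECTRIC statement, which 't Hooft's `ker π`-Fourier
duality with a centre-sensitive positive transfer operator (SPLIT) derives from ELECTRIC TWIST EQUIPARTITION
(EQUI ⟹ EBLIND). Net: crux ⟸ COVER(WEYL) + pullback + MIX(STRUCT, RARE, PSC(SPLIT, EQUI), EQUI, EBLIND(SPLIT, EQUI)).

HOW TO READ THIS FILE.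
* §0 defines the statements as named `Prop`s (documentation + the hypotheses of the composition).
* §1 states the six REGISTERED STUBS `stub_*` with the SAME text fully inline (`let`-free, fully qualified, no
  local definition), so that provers can re-prove them verbatim in `Theorems/*.lean` (`propose --supports
  stmt-QuantumFields-16405`); `sorry` lives only there.
* §2 is the kernel-checked composition: `sectorMixture_of_core` (MIX from the landed core), `coverClustering_of`
  (pure logic over the §0 names + the landed rarity, instantiated with the §1 stubs — this certifies §0 ≡ §1 by
  definitional unfolding), `universalCover_of_weyl`, `clustering_of_cover` (COVER + the landed pullback turn
  `CoverClustering` into the crux body at each `(G, r)`) and the A12 skeleton theorem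
  `NonSimplyConnectedLatticeGap_of : ConvexGribovBody.NonSimplyConnectedLatticeGap` (crux BY NAME, no hypotheses).
* The sector labelling is a POSITED OBJECT given by an inline INTERFACE (eight clauses, see `SectorLabelling`),
  with existence a separate stub (STRUCT-EXIST) — never smuggled: every `∀ cls`-stub is vacuous, not false, if no
  labelling exists, and the interface (unlabelled set pinned to the explicit bad event, locality, clean
  normalisation) excludes the cheap non-topological labellings (e.g. energy thresholds) for which per-sector
  clustering fails at order `L⁻⁴`. Wave-1 caveat (EBLIND audit): proofs of the `∀ cls`-stubs must show the clauses
  pin `cls` a.s. on good configurations (local cleanability of every bad cluster of span `< S/16` inside a radius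
  `S/16` ball — a lattice small-curvature filling lemma), else a relabelling could break blindness; shared by
  MIX/EBLIND/PSC, believed true, unproved.

DISPROOF USED (`Cruxes/NonSimplyConnectedLatticeGap/Disproof.lean`, cycle 1, re-read 2026-08-17): §A1 `n ≤ S` is
load-bearing — honoured at MIX (the bad-event term `C e^{−cS}` and the spread term `e^{−2μ(2S+1)}` are `≤ e^{−m'n}`
only because `n ≤ S`; `mix_rate_bounds`); §A3 non-abelian clause load-bearing modulo `U1WilsonTorusMasslessD4` —
honoured at COVER/WEYL (no compact simply connected cover with finite kernel for `U(1)`) and at EQUI (equipartition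
is false in a Coulomb phase) — every other stub is stated for the cover theories of the common context;
§A2/§B1/§B2 — every clustering shape below keeps `∃ C` after `∀ A B` and uniform in `S` (the new `S_e`/`S₁` are
after `β`, cosmetic by §A2); §A4 — the class is non-empty (`so3_admissible`), and this file's cover context is
inhabited by `(SO(3), S³, rotHom)` (`coverContext_inhabited`; COVER at SO(3) landed p163818); §D —
`stub_sectorIdentity` checked TRUE incl. null parts, used by MIX in its junk-safe form. Landed Negative lemmas
(`FalseWithoutTimeBound`, `Tightness`, `FalseWithoutNonAbelianOfU1Massless`): no stub is an instance they refute
(each stub is either not of clustering shape or carries `n ≤ S` and `∃ C` per pair). Negatives index (5 entries,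
QCD/MirrorModular/… ): none near.
-/

set_option autoImplicit false
set_option linter.unusedVariables false

noncomputable section

namespace Summit.QuantumFields.YangMills.Cruxes.NonSimplyConnectedLatticeGap.TwistEquipartitionBlindness

/-! ## §0 The statements as named propositions

Common context (every statement but COVER's conclusion quantifies over it):
`G` compact simple Lie (the crux's group), `H` compact simple Lie AND simply connected, `π : H →* G` continuous
surjective with `ker π` central, finite, non-trivial (the universal cover; `ker π ≅ π₁(G)`), `ρH` a faithful unitary
representation of `H` (only used to define the CELLS: `h` lies in the cell of `k ∈ ker π` iff `Re tr ρH(k⁻¹h)` is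
strictly maximal among centre translates), `r` the crux's faithful representation of `G` (the `H`-theory is Wilson's
measure for the centre-BLIND representation `r.ρ ∘ π` on the torus `(ℤ/(2S+1))⁴`).

Vocabulary used inline below (all over tree declarations):
* torus distance `dist(x, y) = max_j |(x_j − y_j).valMinAbs|`;
* `Bad_{a,S}(V)`: `S < 64`, or a chain `ch₀ … ch_k` of plaquettes, each with blind action
  `r.N − Re tr r(π(V_{ch_i})) ≥ a`, consecutive base points within distance `3`, end-to-end distance `≥ S/16`;
* sector `E_z = cls_S⁻¹ {some z}`, weight `p_z = μ̃(E_z)`, `μ̃ = wilsonMeasure (r.ρ.comp π) β` on `H^E`;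
* pulled-back observables `Ã(V) = A.F(π ∘ torusLift V)`, `B̃_n(V) = B.F(π ∘ τ_{−n e₀} torusLift V)` — exactly the
  integrands of `latticeConnectedCorr (r.ρ.comp π) β (2S+1) (A.F ∘ (π ∘ ·)) (B.F ∘ (π ∘ ·)) n`;
* `z, w` ELECTRICALLY RELATED: `z q = w q` for every magnetic plane `q = (i, j)`, `0 < i < j` (time axis `0`);
* the SECTOR INTERFACE for `cls_S` at badness `a` (eight clauses): (Xm) measurable fibres; (X0) `cls_S V = none ↔
  Bad_{a,S} V`; (X1) invariance under centre flips `V ↦ ε·V`, `ε : E → ker π`; (X2) gauge invariance; (X6)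
  translation invariance; (X3) LOCALITY: configurations agreeing outside the ball of radius `S/16` about any site and
  both labelled carry the same label; (X4) CLEAN NORMALISATION: if every plaquette holonomy `V_p` lies in the cell
  of `t_z(p)·(dε)_p` (`t_z` = 't Hooft's stack insertion of `z_q` on the plaquette of plane `q` at `x_μ = x_ν = 0`,
  `dε` = plaquette holonomy of the `ker π`-valued link field `ε`) then `cls_S V ∈ {none, some z}`; (X5) AXIS
  EXCHANGE: for every magnetic plane `q` there are an axis permutation `σ` and an injective relabelling `Ψ` with
  `cls_S ∘ configPerm σ = Ψ ∘ cls_S` carrying pairs that differ only at `q` to electrically related pairs.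
-/

/-- The transfer target of COVER: for every cover datum `(G, H, π, ρH, r)` of the common context, the `(H, r∘π)` Wilson theory clusters volume-uniformly in time at weak coupling on pulled-back gauge-invariant local observables of `G` (the `UniformLatticeGap` body for the simply connected `H` in the NON-faithful representation `r∘π`). -/
def CoverClustering : Prop :=
  ∀ (G : Type) [Group G] [TopologicalSpace G] [IsTopologicalGroup G] [CompactSpace G] [MeasurableSpace G] [BorelSpace
    G], Literature.MathematicalPhysics.QuantumFieldTheory.IsCompactSimpleLieGroup G → ∀ (H : Type) [Group H]
    [TopologicalSpace H] [IsTopologicalGroup H] [CompactSpace H] [MeasurableSpace H] [BorelSpace H],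
    Literature.MathematicalPhysics.QuantumFieldTheory.IsCompactSimpleLieGroup H → SimplyConnectedSpace H → ∀ (π : H →*
    G), Continuous π → Function.Surjective π → π.ker ≤ Subgroup.center H → (π.ker : Set H).Finite → π.ker ≠ ⊥ → ∀ (ρH
    : Literature.MathematicalPhysics.QuantumFieldTheory.LatticeRep H) (r :
    Literature.MathematicalPhysics.QuantumFieldTheory.LatticeRep G), ∃ β₀ : ℝ, ∀ β : ℝ, β₀ ≤ β → (∃ m : ℝ, 0 < m ∧ ∃
    S₁ : ℕ, ∀ A B : Literature.MathematicalPhysics.QuantumFieldTheory.YMSpecies G, ∃ C : ℝ, ∀ S n : ℕ, S₁ ≤ S → n ≤ S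
    → |Literature.MathematicalPhysics.QuantumFieldTheory.latticeConnectedCorr (r.ρ.comp π) β (2 * S + 1) (fun V => A.F
    (fun e => π (V e))) (fun V => B.F (fun e => π (V e))) n| ≤ C * Real.exp (-(m * n)))

/-- COVER (transfer, known theorem): every non-simply-connected compact simple Lie group has a compact simply connected compact-simple-Lie cover with finite central non-trivial kernel (Weyl). -/
def UniversalCover : Prop :=
  ∀ (G : Type) [Group G] [TopologicalSpace G] [IsTopologicalGroup G] [CompactSpace G],
    Literature.MathematicalPhysics.QuantumFieldTheory.IsCompactSimpleLieGroup G → ¬ SimplyConnectedSpace G → ∃ (H :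
    Type) (_ : Group H) (_ : TopologicalSpace H) (_ : IsTopologicalGroup H) (_ : CompactSpace H) (_ : MeasurableSpace
    H) (_ : BorelSpace H) (π : H →* G), Literature.MathematicalPhysics.QuantumFieldTheory.IsCompactSimpleLieGroup H ∧
    SimplyConnectedSpace H ∧ Continuous π ∧ Function.Surjective π ∧ π.ker ≤ Subgroup.center H ∧ (π.ker : Set H).Finite
    ∧ π.ker ≠ ⊥

/-- STRUCT-EXIST (construction; v2: existence only — rarity of the bad event is the landed `torusBadEventRare`): a badness threshold `a > 0` and an interface labelling family `cls` (the monopole-corrected 't Hooft class) exist. -/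
def SectorLabelling : Prop :=
  ∀ (G : Type) [Group G] [TopologicalSpace G] [IsTopologicalGroup G] [CompactSpace G] [MeasurableSpace G] [BorelSpace
    G], Literature.MathematicalPhysics.QuantumFieldTheory.IsCompactSimpleLieGroup G → ∀ (H : Type) [Group H]
    [TopologicalSpace H] [IsTopologicalGroup H] [CompactSpace H] [MeasurableSpace H] [BorelSpace H],
    Literature.MathematicalPhysics.QuantumFieldTheory.IsCompactSimpleLieGroup H → SimplyConnectedSpace H → ∀ (π : H →*
    G), Continuous π → Function.Surjective π → π.ker ≤ Subgroup.center H → (π.ker : Set H).Finite → π.ker ≠ ⊥ → ∀ (ρH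
    : Literature.MathematicalPhysics.QuantumFieldTheory.LatticeRep H) (r :
    Literature.MathematicalPhysics.QuantumFieldTheory.LatticeRep G), ∃ a : ℝ, 0 < a ∧ ∃ cls : (∀ S : ℕ,
    Literature.MathematicalPhysics.QuantumFieldTheory.GaugeConfig 4 (2 * S + 1) H → Option ({p : Fin 4 × Fin 4 // p.1
    < p.2} → ↥π.ker)), (∀ S : ℕ, ((∀ o : Option ({p : Fin 4 × Fin 4 // p.1 < p.2} → ↥π.ker), MeasurableSet ((cls S) ⁻¹'
    {o})) ∧ (∀ V : Literature.MathematicalPhysics.QuantumFieldTheory.GaugeConfig 4 (2 * S + 1) H, (cls S) V = none ↔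
    (S < 64 ∨ ∃ (k : ℕ) (ch : Fin (k + 1) → Literature.MathematicalPhysics.QuantumFieldTheory.Plaquette 4 (2 * S +
    1)), (∀ i, a ≤ (r.N : ℝ) - ((r.ρ.comp π) (Literature.MathematicalPhysics.QuantumFieldTheory.plaquetteHolonomy V
    (ch i).1 (ch i).2.1.1 (ch i).2.1.2)).trace.re) ∧ (∀ i : Fin k, (Finset.univ.sup fun j : Fin 4 => (((ch
    i.castSucc).1 j - (ch i.succ).1 j).valMinAbs).natAbs) ≤ 3) ∧ S ≤ 16 * (Finset.univ.sup fun j : Fin 4 => (((ch 0).1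
    j - (ch (Fin.last k)).1 j).valMinAbs).natAbs))) ∧ (∀ (ε : Literature.MathematicalPhysics.QuantumFieldTheory.Edge 4
    (2 * S + 1) → ↥π.ker) (V : Literature.MathematicalPhysics.QuantumFieldTheory.GaugeConfig 4 (2 * S + 1) H), (cls S)
    (fun e => ((ε e : ↥π.ker) : H) * V e) = (cls S) V) ∧ (∀ (g :
    Literature.MathematicalPhysics.QuantumFieldTheory.Site 4 (2 * S + 1) → H) (V :
    Literature.MathematicalPhysics.QuantumFieldTheory.GaugeConfig 4 (2 * S + 1) H), (cls S)
    (Literature.MathematicalPhysics.QuantumFieldTheory.gaugeTransform g V) = (cls S) V) ∧ (∀ (v :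
    Literature.MathematicalPhysics.QuantumFieldTheory.Site 4 (2 * S + 1)) (V :
    Literature.MathematicalPhysics.QuantumFieldTheory.GaugeConfig 4 (2 * S + 1) H), (cls S) (fun e => V (e.1 + v,
    e.2)) = (cls S) V) ∧ (∀ (V V' : Literature.MathematicalPhysics.QuantumFieldTheory.GaugeConfig 4 (2 * S + 1) H) (x₀
    : Literature.MathematicalPhysics.QuantumFieldTheory.Site 4 (2 * S + 1)), (∀ e :
    Literature.MathematicalPhysics.QuantumFieldTheory.Edge 4 (2 * S + 1), S < 16 * (Finset.univ.sup fun j : Fin 4 =>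
    ((e.1 j - x₀ j).valMinAbs).natAbs) → V e = V' e) → (cls S) V ≠ none → (cls S) V' ≠ none → (cls S) V = (cls S) V')
    ∧ (∀ (z : {p : Fin 4 × Fin 4 // p.1 < p.2} → ↥π.ker) (ε : Literature.MathematicalPhysics.QuantumFieldTheory.Edge 4
    (2 * S + 1) → ↥π.ker) (V : Literature.MathematicalPhysics.QuantumFieldTheory.GaugeConfig 4 (2 * S + 1) H), (∀ p :
    Literature.MathematicalPhysics.QuantumFieldTheory.Plaquette 4 (2 * S + 1), (∀ k' : H, k' ∈ π.ker → k' ≠ ((if p.1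
    p.2.1.1 = 0 ∧ p.1 p.2.1.2 = 0 then ((z p.2 : ↥π.ker) : H) else (1 : H)) *
    Literature.MathematicalPhysics.QuantumFieldTheory.plaquetteHolonomy (fun e => ((ε e : ↥π.ker) : H)) p.1 p.2.1.1
    p.2.1.2) → (ρH.ρ (k'⁻¹ * Literature.MathematicalPhysics.QuantumFieldTheory.plaquetteHolonomy V p.1 p.2.1.1
    p.2.1.2)).trace.re < (ρH.ρ ((((if p.1 p.2.1.1 = 0 ∧ p.1 p.2.1.2 = 0 then ((z p.2 : ↥π.ker) : H) else (1 : H)) *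
    Literature.MathematicalPhysics.QuantumFieldTheory.plaquetteHolonomy (fun e => ((ε e : ↥π.ker) : H)) p.1 p.2.1.1
    p.2.1.2))⁻¹ * Literature.MathematicalPhysics.QuantumFieldTheory.plaquetteHolonomy V p.1 p.2.1.1
    p.2.1.2)).trace.re)) → (cls S) V = none ∨ (cls S) V = some z) ∧ (∀ q : {p : Fin 4 × Fin 4 // p.1 < p.2}, q.1.1 ≠ 0
    → ∃ (σ : Equiv.Perm (Fin 4)) (Ψ : ({p : Fin 4 × Fin 4 // p.1 < p.2} → ↥π.ker) → ({p : Fin 4 × Fin 4 // p.1 < p.2}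
    → ↥π.ker)), Function.Injective Ψ ∧ (∀ V : Literature.MathematicalPhysics.QuantumFieldTheory.GaugeConfig 4 (2 * S +
    1) H, (cls S) (Literature.MathematicalPhysics.QuantumFieldTheory.configPerm σ V) = ((cls S) V).map Ψ) ∧ (∀ z w :
    {p : Fin 4 × Fin 4 // p.1 < p.2} → ↥π.ker, (∀ q' : {p : Fin 4 × Fin 4 // p.1 < p.2}, q' ≠ q → z q' = w q') → ∀ q''
    : {p : Fin 4 × Fin 4 // p.1 < p.2}, q''.1.1 ≠ 0 → Ψ z q'' = Ψ w q''))))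

/-- MIX (v2: equipartition only from `S_e` on; PROVED below from the landed `mix_core`): for any interface labelling family — small bad event, per-sector clustering, electric equipartition and electric blindness at `β` give the clustering body at `β`. -/
def SectorMixture : Prop :=
  ∀ (G : Type) [Group G] [TopologicalSpace G] [IsTopologicalGroup G] [CompactSpace G] [MeasurableSpace G] [BorelSpace
    G], Literature.MathematicalPhysics.QuantumFieldTheory.IsCompactSimpleLieGroup G → ∀ (H : Type) [Group H]
    [TopologicalSpace H] [IsTopologicalGroup H] [CompactSpace H] [MeasurableSpace H] [BorelSpace H],
    Literature.MathematicalPhysics.QuantumFieldTheory.IsCompactSimpleLieGroup H → SimplyConnectedSpace H → ∀ (π : H →*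
    G), Continuous π → Function.Surjective π → π.ker ≤ Subgroup.center H → (π.ker : Set H).Finite → π.ker ≠ ⊥ → ∀ (ρH
    : Literature.MathematicalPhysics.QuantumFieldTheory.LatticeRep H) (r :
    Literature.MathematicalPhysics.QuantumFieldTheory.LatticeRep G), ∀ (a β : ℝ) (cls : ∀ S : ℕ,
    Literature.MathematicalPhysics.QuantumFieldTheory.GaugeConfig 4 (2 * S + 1) H → Option ({p : Fin 4 × Fin 4 // p.1
    < p.2} → ↥π.ker)), (∀ S : ℕ, ((∀ o : Option ({p : Fin 4 × Fin 4 // p.1 < p.2} → ↥π.ker), MeasurableSet ((cls S) ⁻¹'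
    {o})) ∧ (∀ V : Literature.MathematicalPhysics.QuantumFieldTheory.GaugeConfig 4 (2 * S + 1) H, (cls S) V = none ↔
    (S < 64 ∨ ∃ (k : ℕ) (ch : Fin (k + 1) → Literature.MathematicalPhysics.QuantumFieldTheory.Plaquette 4 (2 * S +
    1)), (∀ i, a ≤ (r.N : ℝ) - ((r.ρ.comp π) (Literature.MathematicalPhysics.QuantumFieldTheory.plaquetteHolonomy V
    (ch i).1 (ch i).2.1.1 (ch i).2.1.2)).trace.re) ∧ (∀ i : Fin k, (Finset.univ.sup fun j : Fin 4 => (((ch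
    i.castSucc).1 j - (ch i.succ).1 j).valMinAbs).natAbs) ≤ 3) ∧ S ≤ 16 * (Finset.univ.sup fun j : Fin 4 => (((ch 0).1
    j - (ch (Fin.last k)).1 j).valMinAbs).natAbs))) ∧ (∀ (ε : Literature.MathematicalPhysics.QuantumFieldTheory.Edge 4
    (2 * S + 1) → ↥π.ker) (V : Literature.MathematicalPhysics.QuantumFieldTheory.GaugeConfig 4 (2 * S + 1) H), (cls S)
    (fun e => ((ε e : ↥π.ker) : H) * V e) = (cls S) V) ∧ (∀ (g :
    Literature.MathematicalPhysics.QuantumFieldTheory.Site 4 (2 * S + 1) → H) (V :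
    Literature.MathematicalPhysics.QuantumFieldTheory.GaugeConfig 4 (2 * S + 1) H), (cls S)
    (Literature.MathematicalPhysics.QuantumFieldTheory.gaugeTransform g V) = (cls S) V) ∧ (∀ (v :
    Literature.MathematicalPhysics.QuantumFieldTheory.Site 4 (2 * S + 1)) (V :
    Literature.MathematicalPhysics.QuantumFieldTheory.GaugeConfig 4 (2 * S + 1) H), (cls S) (fun e => V (e.1 + v,
    e.2)) = (cls S) V) ∧ (∀ (V V' : Literature.MathematicalPhysics.QuantumFieldTheory.GaugeConfig 4 (2 * S + 1) H) (x₀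
    : Literature.MathematicalPhysics.QuantumFieldTheory.Site 4 (2 * S + 1)), (∀ e :
    Literature.MathematicalPhysics.QuantumFieldTheory.Edge 4 (2 * S + 1), S < 16 * (Finset.univ.sup fun j : Fin 4 =>
    ((e.1 j - x₀ j).valMinAbs).natAbs) → V e = V' e) → (cls S) V ≠ none → (cls S) V' ≠ none → (cls S) V = (cls S) V')
    ∧ (∀ (z : {p : Fin 4 × Fin 4 // p.1 < p.2} → ↥π.ker) (ε : Literature.MathematicalPhysics.QuantumFieldTheory.Edge 4
    (2 * S + 1) → ↥π.ker) (V : Literature.MathematicalPhysics.QuantumFieldTheory.GaugeConfig 4 (2 * S + 1) H), (∀ p :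
    Literature.MathematicalPhysics.QuantumFieldTheory.Plaquette 4 (2 * S + 1), (∀ k' : H, k' ∈ π.ker → k' ≠ ((if p.1
    p.2.1.1 = 0 ∧ p.1 p.2.1.2 = 0 then ((z p.2 : ↥π.ker) : H) else (1 : H)) *
    Literature.MathematicalPhysics.QuantumFieldTheory.plaquetteHolonomy (fun e => ((ε e : ↥π.ker) : H)) p.1 p.2.1.1
    p.2.1.2) → (ρH.ρ (k'⁻¹ * Literature.MathematicalPhysics.QuantumFieldTheory.plaquetteHolonomy V p.1 p.2.1.1
    p.2.1.2)).trace.re < (ρH.ρ ((((if p.1 p.2.1.1 = 0 ∧ p.1 p.2.1.2 = 0 then ((z p.2 : ↥π.ker) : H) else (1 : H)) *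
    Literature.MathematicalPhysics.QuantumFieldTheory.plaquetteHolonomy (fun e => ((ε e : ↥π.ker) : H)) p.1 p.2.1.1
    p.2.1.2))⁻¹ * Literature.MathematicalPhysics.QuantumFieldTheory.plaquetteHolonomy V p.1 p.2.1.1
    p.2.1.2)).trace.re)) → (cls S) V = none ∨ (cls S) V = some z) ∧ (∀ q : {p : Fin 4 × Fin 4 // p.1 < p.2}, q.1.1 ≠ 0
    → ∃ (σ : Equiv.Perm (Fin 4)) (Ψ : ({p : Fin 4 × Fin 4 // p.1 < p.2} → ↥π.ker) → ({p : Fin 4 × Fin 4 // p.1 < p.2}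
    → ↥π.ker)), Function.Injective Ψ ∧ (∀ V : Literature.MathematicalPhysics.QuantumFieldTheory.GaugeConfig 4 (2 * S +
    1) H, (cls S) (Literature.MathematicalPhysics.QuantumFieldTheory.configPerm σ V) = ((cls S) V).map Ψ) ∧ (∀ z w :
    {p : Fin 4 × Fin 4 // p.1 < p.2} → ↥π.ker, (∀ q' : {p : Fin 4 × Fin 4 // p.1 < p.2}, q' ≠ q → z q' = w q') → ∀ q''
    : {p : Fin 4 × Fin 4 // p.1 < p.2}, q''.1.1 ≠ 0 → Ψ z q'' = Ψ w q'')))) → (∃ c : ℝ, 0 < c ∧ ∃ C : ℝ, ∀ S : ℕ,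
    ((Literature.MathematicalPhysics.QuantumFieldTheory.wilsonMeasure (r.ρ.comp π) β : MeasureTheory.Measure
    (Literature.MathematicalPhysics.QuantumFieldTheory.GaugeConfig 4 (2 * S + 1) H)) ((cls S) ⁻¹' {none})).toReal ≤ C
    * Real.exp (-(c * S))) → (∃ m : ℝ, 0 < m ∧ ∀ A B : Literature.MathematicalPhysics.QuantumFieldTheory.YMSpecies G,
    ∃ C : ℝ, ∀ (S n : ℕ) (z : {p : Fin 4 × Fin 4 // p.1 < p.2} → ↥π.ker), n ≤ S → |(∫ V in ((cls S) ⁻¹' {some z}), A.F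
    (fun e => π (Literature.MathematicalPhysics.QuantumLattice.torusLift (2 * S + 1) V e)) * B.F (fun e => π
    (Literature.MathematicalPhysics.QuantumLattice.configShift (-Pi.single 0 (n : ℤ))
    (Literature.MathematicalPhysics.QuantumLattice.torusLift (2 * S + 1) V) e))
    ∂(Literature.MathematicalPhysics.QuantumFieldTheory.wilsonMeasure (r.ρ.comp π) β : MeasureTheory.Measure
    (Literature.MathematicalPhysics.QuantumFieldTheory.GaugeConfig 4 (2 * S + 1) H))) -
    (((Literature.MathematicalPhysics.QuantumFieldTheory.wilsonMeasure (r.ρ.comp π) β : MeasureTheory.Measure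
    (Literature.MathematicalPhysics.QuantumFieldTheory.GaugeConfig 4 (2 * S + 1) H)) ((cls S) ⁻¹' {some z})).toReal)⁻¹
    * (∫ V in ((cls S) ⁻¹' {some z}), A.F (fun e => π (Literature.MathematicalPhysics.QuantumLattice.torusLift (2 * S
    + 1) V e)) ∂(Literature.MathematicalPhysics.QuantumFieldTheory.wilsonMeasure (r.ρ.comp π) β :
    MeasureTheory.Measure (Literature.MathematicalPhysics.QuantumFieldTheory.GaugeConfig 4 (2 * S + 1) H))) * (∫ V in
    ((cls S) ⁻¹' {some z}), B.F (fun e => π (Literature.MathematicalPhysics.QuantumLattice.configShift (-Pi.single 0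
    (n : ℤ)) (Literature.MathematicalPhysics.QuantumLattice.torusLift (2 * S + 1) V) e))
    ∂(Literature.MathematicalPhysics.QuantumFieldTheory.wilsonMeasure (r.ρ.comp π) β : MeasureTheory.Measure
    (Literature.MathematicalPhysics.QuantumFieldTheory.GaugeConfig 4 (2 * S + 1) H)))| ≤ C * Real.exp (-(m * n)) *
    ((Literature.MathematicalPhysics.QuantumFieldTheory.wilsonMeasure (r.ρ.comp π) β : MeasureTheory.Measure
    (Literature.MathematicalPhysics.QuantumFieldTheory.GaugeConfig 4 (2 * S + 1) H)) ((cls S) ⁻¹' {some z})).toReal) →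
    (∃ μ : ℝ, 0 < μ ∧ ∃ (S_e : ℕ) (C : ℝ), ∀ (S : ℕ) (z w : {p : Fin 4 × Fin 4 // p.1 < p.2} → ↥π.ker), S_e ≤ S →
    (∀ q : {p : Fin 4 × Fin 4 // p.1 < p.2}, q.1.1 ≠ 0 → z q = w q) → |((Literature.MathematicalPhysics.QuantumFieldTheory.wilsonMeasure
    (r.ρ.comp π) β : MeasureTheory.Measure (Literature.MathematicalPhysics.QuantumFieldTheory.GaugeConfig 4 (2 * S +
    1) H)) ((cls S) ⁻¹' {some z})).toReal - ((Literature.MathematicalPhysics.QuantumFieldTheory.wilsonMeasure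
    (r.ρ.comp π) β : MeasureTheory.Measure (Literature.MathematicalPhysics.QuantumFieldTheory.GaugeConfig 4 (2 * S +
    1) H)) ((cls S) ⁻¹' {some w})).toReal| ≤ C * Real.exp (-(μ * (2 * (S : ℝ) + 1))) *
    ((Literature.MathematicalPhysics.QuantumFieldTheory.wilsonMeasure (r.ρ.comp π) β : MeasureTheory.Measure
    (Literature.MathematicalPhysics.QuantumFieldTheory.GaugeConfig 4 (2 * S + 1) H)) ((cls S) ⁻¹' {some w})).toReal) →
    (∃ μ : ℝ, 0 < μ ∧ ∀ A : Literature.MathematicalPhysics.QuantumFieldTheory.YMSpecies G, ∃ C : ℝ, ∀ (S : ℕ) (z w :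
    {p : Fin 4 × Fin 4 // p.1 < p.2} → ↥π.ker), (∀ q : {p : Fin 4 × Fin 4 // p.1 < p.2}, q.1.1 ≠ 0 → z q = w q) → |((Literature.MathematicalPhysics.QuantumFieldTheory.wilsonMeasure
    (r.ρ.comp π) β : MeasureTheory.Measure (Literature.MathematicalPhysics.QuantumFieldTheory.GaugeConfig 4 (2 * S +
    1) H)) ((cls S) ⁻¹' {some w})).toReal * (∫ V in ((cls S) ⁻¹' {some z}), A.F (fun e => π
    (Literature.MathematicalPhysics.QuantumLattice.torusLift (2 * S + 1) V e))
    ∂(Literature.MathematicalPhysics.QuantumFieldTheory.wilsonMeasure (r.ρ.comp π) β : MeasureTheory.Measure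
    (Literature.MathematicalPhysics.QuantumFieldTheory.GaugeConfig 4 (2 * S + 1) H))) -
    ((Literature.MathematicalPhysics.QuantumFieldTheory.wilsonMeasure (r.ρ.comp π) β : MeasureTheory.Measure
    (Literature.MathematicalPhysics.QuantumFieldTheory.GaugeConfig 4 (2 * S + 1) H)) ((cls S) ⁻¹' {some z})).toReal *
    (∫ V in ((cls S) ⁻¹' {some w}), A.F (fun e => π (Literature.MathematicalPhysics.QuantumLattice.torusLift (2 * S +
    1) V e)) ∂(Literature.MathematicalPhysics.QuantumFieldTheory.wilsonMeasure (r.ρ.comp π) β : MeasureTheory.Measure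
    (Literature.MathematicalPhysics.QuantumFieldTheory.GaugeConfig 4 (2 * S + 1) H)))| ≤ C * Real.exp (-(μ * (2 * (S :
    ℝ) + 1))) * ((Literature.MathematicalPhysics.QuantumFieldTheory.wilsonMeasure (r.ρ.comp π) β :
    MeasureTheory.Measure (Literature.MathematicalPhysics.QuantumFieldTheory.GaugeConfig 4 (2 * S + 1) H)) ((cls S) ⁻¹'
    {some z})).toReal * ((Literature.MathematicalPhysics.QuantumFieldTheory.wilsonMeasure (r.ρ.comp π) β :
    MeasureTheory.Measure (Literature.MathematicalPhysics.QuantumFieldTheory.GaugeConfig 4 (2 * S + 1) H)) ((cls S) ⁻¹'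
    {some w})).toReal) → (∃ m : ℝ, 0 < m ∧ ∃ S₁ : ℕ, ∀ A B :
    Literature.MathematicalPhysics.QuantumFieldTheory.YMSpecies G, ∃ C : ℝ, ∀ S n : ℕ, S₁ ≤ S → n ≤ S → |Literature.MathematicalPhysics.QuantumFieldTheory.latticeConnectedCorr
    (r.ρ.comp π) β (2 * S + 1) (fun V => A.F (fun e => π (V e))) (fun V => B.F (fun e => π (V e))) n| ≤ C * Real.exp
    (-(m * n)))

/-- EQUI (v2: on tori `S ≥ S_e`, `S_e` after `β`): electric twist equipartition at large `β` for any interface labelling family. -/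
def TwistEquipartition : Prop :=
  ∀ (G : Type) [Group G] [TopologicalSpace G] [IsTopologicalGroup G] [CompactSpace G] [MeasurableSpace G] [BorelSpace
    G], Literature.MathematicalPhysics.QuantumFieldTheory.IsCompactSimpleLieGroup G → ∀ (H : Type) [Group H]
    [TopologicalSpace H] [IsTopologicalGroup H] [CompactSpace H] [MeasurableSpace H] [BorelSpace H],
    Literature.MathematicalPhysics.QuantumFieldTheory.IsCompactSimpleLieGroup H → SimplyConnectedSpace H → ∀ (π : H →*
    G), Continuous π → Function.Surjective π → π.ker ≤ Subgroup.center H → (π.ker : Set H).Finite → π.ker ≠ ⊥ → ∀ (ρH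
    : Literature.MathematicalPhysics.QuantumFieldTheory.LatticeRep H) (r :
    Literature.MathematicalPhysics.QuantumFieldTheory.LatticeRep G), ∀ (a : ℝ) (cls : ∀ S : ℕ,
    Literature.MathematicalPhysics.QuantumFieldTheory.GaugeConfig 4 (2 * S + 1) H → Option ({p : Fin 4 × Fin 4 // p.1
    < p.2} → ↥π.ker)), (∀ S : ℕ, ((∀ o : Option ({p : Fin 4 × Fin 4 // p.1 < p.2} → ↥π.ker), MeasurableSet ((cls S) ⁻¹'
    {o})) ∧ (∀ V : Literature.MathematicalPhysics.QuantumFieldTheory.GaugeConfig 4 (2 * S + 1) H, (cls S) V = none ↔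
    (S < 64 ∨ ∃ (k : ℕ) (ch : Fin (k + 1) → Literature.MathematicalPhysics.QuantumFieldTheory.Plaquette 4 (2 * S +
    1)), (∀ i, a ≤ (r.N : ℝ) - ((r.ρ.comp π) (Literature.MathematicalPhysics.QuantumFieldTheory.plaquetteHolonomy V
    (ch i).1 (ch i).2.1.1 (ch i).2.1.2)).trace.re) ∧ (∀ i : Fin k, (Finset.univ.sup fun j : Fin 4 => (((ch
    i.castSucc).1 j - (ch i.succ).1 j).valMinAbs).natAbs) ≤ 3) ∧ S ≤ 16 * (Finset.univ.sup fun j : Fin 4 => (((ch 0).1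
    j - (ch (Fin.last k)).1 j).valMinAbs).natAbs))) ∧ (∀ (ε : Literature.MathematicalPhysics.QuantumFieldTheory.Edge 4
    (2 * S + 1) → ↥π.ker) (V : Literature.MathematicalPhysics.QuantumFieldTheory.GaugeConfig 4 (2 * S + 1) H), (cls S)
    (fun e => ((ε e : ↥π.ker) : H) * V e) = (cls S) V) ∧ (∀ (g :
    Literature.MathematicalPhysics.QuantumFieldTheory.Site 4 (2 * S + 1) → H) (V :
    Literature.MathematicalPhysics.QuantumFieldTheory.GaugeConfig 4 (2 * S + 1) H), (cls S)
    (Literature.MathematicalPhysics.QuantumFieldTheory.gaugeTransform g V) = (cls S) V) ∧ (∀ (v :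
    Literature.MathematicalPhysics.QuantumFieldTheory.Site 4 (2 * S + 1)) (V :
    Literature.MathematicalPhysics.QuantumFieldTheory.GaugeConfig 4 (2 * S + 1) H), (cls S) (fun e => V (e.1 + v,
    e.2)) = (cls S) V) ∧ (∀ (V V' : Literature.MathematicalPhysics.QuantumFieldTheory.GaugeConfig 4 (2 * S + 1) H) (x₀
    : Literature.MathematicalPhysics.QuantumFieldTheory.Site 4 (2 * S + 1)), (∀ e :
    Literature.MathematicalPhysics.QuantumFieldTheory.Edge 4 (2 * S + 1), S < 16 * (Finset.univ.sup fun j : Fin 4 =>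
    ((e.1 j - x₀ j).valMinAbs).natAbs) → V e = V' e) → (cls S) V ≠ none → (cls S) V' ≠ none → (cls S) V = (cls S) V')
    ∧ (∀ (z : {p : Fin 4 × Fin 4 // p.1 < p.2} → ↥π.ker) (ε : Literature.MathematicalPhysics.QuantumFieldTheory.Edge 4
    (2 * S + 1) → ↥π.ker) (V : Literature.MathematicalPhysics.QuantumFieldTheory.GaugeConfig 4 (2 * S + 1) H), (∀ p :
    Literature.MathematicalPhysics.QuantumFieldTheory.Plaquette 4 (2 * S + 1), (∀ k' : H, k' ∈ π.ker → k' ≠ ((if p.1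
    p.2.1.1 = 0 ∧ p.1 p.2.1.2 = 0 then ((z p.2 : ↥π.ker) : H) else (1 : H)) *
    Literature.MathematicalPhysics.QuantumFieldTheory.plaquetteHolonomy (fun e => ((ε e : ↥π.ker) : H)) p.1 p.2.1.1
    p.2.1.2) → (ρH.ρ (k'⁻¹ * Literature.MathematicalPhysics.QuantumFieldTheory.plaquetteHolonomy V p.1 p.2.1.1
    p.2.1.2)).trace.re < (ρH.ρ ((((if p.1 p.2.1.1 = 0 ∧ p.1 p.2.1.2 = 0 then ((z p.2 : ↥π.ker) : H) else (1 : H)) *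
    Literature.MathematicalPhysics.QuantumFieldTheory.plaquetteHolonomy (fun e => ((ε e : ↥π.ker) : H)) p.1 p.2.1.1
    p.2.1.2))⁻¹ * Literature.MathematicalPhysics.QuantumFieldTheory.plaquetteHolonomy V p.1 p.2.1.1
    p.2.1.2)).trace.re)) → (cls S) V = none ∨ (cls S) V = some z) ∧ (∀ q : {p : Fin 4 × Fin 4 // p.1 < p.2}, q.1.1 ≠ 0
    → ∃ (σ : Equiv.Perm (Fin 4)) (Ψ : ({p : Fin 4 × Fin 4 // p.1 < p.2} → ↥π.ker) → ({p : Fin 4 × Fin 4 // p.1 < p.2}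
    → ↥π.ker)), Function.Injective Ψ ∧ (∀ V : Literature.MathematicalPhysics.QuantumFieldTheory.GaugeConfig 4 (2 * S +
    1) H, (cls S) (Literature.MathematicalPhysics.QuantumFieldTheory.configPerm σ V) = ((cls S) V).map Ψ) ∧ (∀ z w :
    {p : Fin 4 × Fin 4 // p.1 < p.2} → ↥π.ker, (∀ q' : {p : Fin 4 × Fin 4 // p.1 < p.2}, q' ≠ q → z q' = w q') → ∀ q''
    : {p : Fin 4 × Fin 4 // p.1 < p.2}, q''.1.1 ≠ 0 → Ψ z q'' = Ψ w q'')))) → ∃ β_e : ℝ, ∀ β : ℝ, β_e ≤ β → (∃ μ : ℝ, 0 < μ ∧ ∃ (S_e : ℕ) (C : ℝ), ∀ (S : ℕ) (z w : {p : Fin 4 × Fin 4 // p.1 < p.2} → ↥π.ker), S_e ≤ S →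
    (∀ q : {p : Fin 4 × Fin 4 // p.1 < p.2}, q.1.1 ≠ 0 → z q = w q) → |((Literature.MathematicalPhysics.QuantumFieldTheory.wilsonMeasure (r.ρ.comp π) β :
    MeasureTheory.Measure (Literature.MathematicalPhysics.QuantumFieldTheory.GaugeConfig 4 (2 * S + 1) H)) ((cls S) ⁻¹'
    {some z})).toReal - ((Literature.MathematicalPhysics.QuantumFieldTheory.wilsonMeasure (r.ρ.comp π) β :
    MeasureTheory.Measure (Literature.MathematicalPhysics.QuantumFieldTheory.GaugeConfig 4 (2 * S + 1) H)) ((cls S) ⁻¹'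
    {some w})).toReal| ≤ C * Real.exp (-(μ * (2 * (S : ℝ) + 1))) *
    ((Literature.MathematicalPhysics.QuantumFieldTheory.wilsonMeasure (r.ρ.comp π) β : MeasureTheory.Measure
    (Literature.MathematicalPhysics.QuantumFieldTheory.GaugeConfig 4 (2 * S + 1) H)) ((cls S) ⁻¹' {some w})).toReal)

/-- SPLIT: the positive-type centre-sensitive splitting `w` of the centre-blind Wilson weight with label noise `≤ e^{−cβ}` exists at large `β`. -/
def CentreSplitting : Prop :=
  ∀ (G : Type) [Group G] [TopologicalSpace G] [IsTopologicalGroup G] [CompactSpace G] [MeasurableSpace G] [BorelSpace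
    G], Literature.MathematicalPhysics.QuantumFieldTheory.IsCompactSimpleLieGroup G → ∀ (H : Type) [Group H]
    [TopologicalSpace H] [IsTopologicalGroup H] [CompactSpace H] [MeasurableSpace H] [BorelSpace H],
    Literature.MathematicalPhysics.QuantumFieldTheory.IsCompactSimpleLieGroup H → SimplyConnectedSpace H → ∀ (π : H →*
    G), Continuous π → Function.Surjective π → π.ker ≤ Subgroup.center H → (π.ker : Set H).Finite → π.ker ≠ ⊥ → ∀ (ρH
    : Literature.MathematicalPhysics.QuantumFieldTheory.LatticeRep H) (r :
    Literature.MathematicalPhysics.QuantumFieldTheory.LatticeRep G), ∃ c : ℝ, 0 < c ∧ ∃ β_s : ℝ, ∀ β : ℝ, β_s ≤ β → (∃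
    w : H → ℝ, Continuous w ∧ (∀ h, 0 ≤ w h) ∧ (∀ h, w h⁻¹ = w h) ∧ (∀ g h, w (g * h * g⁻¹) = w h) ∧ (∀ (n : ℕ) (x :
    Fin n → H) (v : Fin n → ℂ), 0 ≤ (∑ i, ∑ j, (starRingEnd ℂ) (v i) * v j * ((w ((x i)⁻¹ * x j) : ℝ) : ℂ)).re) ∧ (∀
    h, ∑ᶠ k ∈ (π.ker : Set H), w (k * h) = Real.exp (β * (r.ρ (π h)).trace.re)) ∧ (∫ h in {h : H | (∀ k' : H, k' ∈
    π.ker → k' ≠ 1 → (ρH.ρ (k'⁻¹ * h)).trace.re < (ρH.ρ h).trace.re)}, (Real.exp (β * (r.ρ (π h)).trace.re) - w h)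
    ∂(Literature.MathematicalPhysics.QuantumFieldTheory.haarProbability H) ≤ Real.exp (-(c * β)) * ∫ h, w h
    ∂(Literature.MathematicalPhysics.QuantumFieldTheory.haarProbability H)))

/-- EBLIND: splitting weight + electric equipartition ⇒ electric blindness of pulled-back local observables, at large `β`. -/
def ElectricBlindnessOfEquipartition : Prop :=
  ∀ (G : Type) [Group G] [TopologicalSpace G] [IsTopologicalGroup G] [CompactSpace G] [MeasurableSpace G] [BorelSpace
    G], Literature.MathematicalPhysics.QuantumFieldTheory.IsCompactSimpleLieGroup G → ∀ (H : Type) [Group H]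
    [TopologicalSpace H] [IsTopologicalGroup H] [CompactSpace H] [MeasurableSpace H] [BorelSpace H],
    Literature.MathematicalPhysics.QuantumFieldTheory.IsCompactSimpleLieGroup H → SimplyConnectedSpace H → ∀ (π : H →*
    G), Continuous π → Function.Surjective π → π.ker ≤ Subgroup.center H → (π.ker : Set H).Finite → π.ker ≠ ⊥ → ∀ (ρH
    : Literature.MathematicalPhysics.QuantumFieldTheory.LatticeRep H) (r :
    Literature.MathematicalPhysics.QuantumFieldTheory.LatticeRep G), ∀ (a : ℝ) (cls : ∀ S : ℕ,
    Literature.MathematicalPhysics.QuantumFieldTheory.GaugeConfig 4 (2 * S + 1) H → Option ({p : Fin 4 × Fin 4 // p.1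
    < p.2} → ↥π.ker)), (∀ S : ℕ, ((∀ o : Option ({p : Fin 4 × Fin 4 // p.1 < p.2} → ↥π.ker), MeasurableSet ((cls S) ⁻¹'
    {o})) ∧ (∀ V : Literature.MathematicalPhysics.QuantumFieldTheory.GaugeConfig 4 (2 * S + 1) H, (cls S) V = none ↔
    (S < 64 ∨ ∃ (k : ℕ) (ch : Fin (k + 1) → Literature.MathematicalPhysics.QuantumFieldTheory.Plaquette 4 (2 * S +
    1)), (∀ i, a ≤ (r.N : ℝ) - ((r.ρ.comp π) (Literature.MathematicalPhysics.QuantumFieldTheory.plaquetteHolonomy V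
    (ch i).1 (ch i).2.1.1 (ch i).2.1.2)).trace.re) ∧ (∀ i : Fin k, (Finset.univ.sup fun j : Fin 4 => (((ch
    i.castSucc).1 j - (ch i.succ).1 j).valMinAbs).natAbs) ≤ 3) ∧ S ≤ 16 * (Finset.univ.sup fun j : Fin 4 => (((ch 0).1
    j - (ch (Fin.last k)).1 j).valMinAbs).natAbs))) ∧ (∀ (ε : Literature.MathematicalPhysics.QuantumFieldTheory.Edge 4
    (2 * S + 1) → ↥π.ker) (V : Literature.MathematicalPhysics.QuantumFieldTheory.GaugeConfig 4 (2 * S + 1) H), (cls S)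
    (fun e => ((ε e : ↥π.ker) : H) * V e) = (cls S) V) ∧ (∀ (g :
    Literature.MathematicalPhysics.QuantumFieldTheory.Site 4 (2 * S + 1) → H) (V :
    Literature.MathematicalPhysics.QuantumFieldTheory.GaugeConfig 4 (2 * S + 1) H), (cls S)
    (Literature.MathematicalPhysics.QuantumFieldTheory.gaugeTransform g V) = (cls S) V) ∧ (∀ (v :
    Literature.MathematicalPhysics.QuantumFieldTheory.Site 4 (2 * S + 1)) (V :
    Literature.MathematicalPhysics.QuantumFieldTheory.GaugeConfig 4 (2 * S + 1) H), (cls S) (fun e => V (e.1 + v,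
    e.2)) = (cls S) V) ∧ (∀ (V V' : Literature.MathematicalPhysics.QuantumFieldTheory.GaugeConfig 4 (2 * S + 1) H) (x₀
    : Literature.MathematicalPhysics.QuantumFieldTheory.Site 4 (2 * S + 1)), (∀ e :
    Literature.MathematicalPhysics.QuantumFieldTheory.Edge 4 (2 * S + 1), S < 16 * (Finset.univ.sup fun j : Fin 4 =>
    ((e.1 j - x₀ j).valMinAbs).natAbs) → V e = V' e) → (cls S) V ≠ none → (cls S) V' ≠ none → (cls S) V = (cls S) V')
    ∧ (∀ (z : {p : Fin 4 × Fin 4 // p.1 < p.2} → ↥π.ker) (ε : Literature.MathematicalPhysics.QuantumFieldTheory.Edge 4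
    (2 * S + 1) → ↥π.ker) (V : Literature.MathematicalPhysics.QuantumFieldTheory.GaugeConfig 4 (2 * S + 1) H), (∀ p :
    Literature.MathematicalPhysics.QuantumFieldTheory.Plaquette 4 (2 * S + 1), (∀ k' : H, k' ∈ π.ker → k' ≠ ((if p.1
    p.2.1.1 = 0 ∧ p.1 p.2.1.2 = 0 then ((z p.2 : ↥π.ker) : H) else (1 : H)) *
    Literature.MathematicalPhysics.QuantumFieldTheory.plaquetteHolonomy (fun e => ((ε e : ↥π.ker) : H)) p.1 p.2.1.1
    p.2.1.2) → (ρH.ρ (k'⁻¹ * Literature.MathematicalPhysics.QuantumFieldTheory.plaquetteHolonomy V p.1 p.2.1.1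
    p.2.1.2)).trace.re < (ρH.ρ ((((if p.1 p.2.1.1 = 0 ∧ p.1 p.2.1.2 = 0 then ((z p.2 : ↥π.ker) : H) else (1 : H)) *
    Literature.MathematicalPhysics.QuantumFieldTheory.plaquetteHolonomy (fun e => ((ε e : ↥π.ker) : H)) p.1 p.2.1.1
    p.2.1.2))⁻¹ * Literature.MathematicalPhysics.QuantumFieldTheory.plaquetteHolonomy V p.1 p.2.1.1
    p.2.1.2)).trace.re)) → (cls S) V = none ∨ (cls S) V = some z) ∧ (∀ q : {p : Fin 4 × Fin 4 // p.1 < p.2}, q.1.1 ≠ 0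
    → ∃ (σ : Equiv.Perm (Fin 4)) (Ψ : ({p : Fin 4 × Fin 4 // p.1 < p.2} → ↥π.ker) → ({p : Fin 4 × Fin 4 // p.1 < p.2}
    → ↥π.ker)), Function.Injective Ψ ∧ (∀ V : Literature.MathematicalPhysics.QuantumFieldTheory.GaugeConfig 4 (2 * S +
    1) H, (cls S) (Literature.MathematicalPhysics.QuantumFieldTheory.configPerm σ V) = ((cls S) V).map Ψ) ∧ (∀ z w :
    {p : Fin 4 × Fin 4 // p.1 < p.2} → ↥π.ker, (∀ q' : {p : Fin 4 × Fin 4 // p.1 < p.2}, q' ≠ q → z q' = w q') → ∀ q''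
    : {p : Fin 4 × Fin 4 // p.1 < p.2}, q''.1.1 ≠ 0 → Ψ z q'' = Ψ w q'')))) → ∀ c : ℝ, 0 < c → ∃ β_b : ℝ, ∀ β : ℝ, β_b
    ≤ β → (∃ w : H → ℝ, Continuous w ∧ (∀ h, 0 ≤ w h) ∧ (∀ h, w h⁻¹ = w h) ∧ (∀ g h, w (g * h * g⁻¹) = w h) ∧ (∀ (n :
    ℕ) (x : Fin n → H) (v : Fin n → ℂ), 0 ≤ (∑ i, ∑ j, (starRingEnd ℂ) (v i) * v j * ((w ((x i)⁻¹ * x j) : ℝ) :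
    ℂ)).re) ∧ (∀ h, ∑ᶠ k ∈ (π.ker : Set H), w (k * h) = Real.exp (β * (r.ρ (π h)).trace.re)) ∧ (∫ h in {h : H | (∀ k'
    : H, k' ∈ π.ker → k' ≠ 1 → (ρH.ρ (k'⁻¹ * h)).trace.re < (ρH.ρ h).trace.re)}, (Real.exp (β * (r.ρ (π h)).trace.re) -
    w h) ∂(Literature.MathematicalPhysics.QuantumFieldTheory.haarProbability H) ≤ Real.exp (-(c * β)) * ∫ h, w h
    ∂(Literature.MathematicalPhysics.QuantumFieldTheory.haarProbability H))) → (∃ μ : ℝ, 0 < μ ∧ ∃ (S_e : ℕ) (C : ℝ), ∀ (S : ℕ) (z w : {p : Fin 4 × Fin 4 // p.1 < p.2} → ↥π.ker), S_e ≤ S →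
    (∀ q : {p : Fin 4 × Fin 4 // p.1 < p.2}, q.1.1 ≠ 0 → z q = w q) → |((Literature.MathematicalPhysics.QuantumFieldTheory.wilsonMeasure
    (r.ρ.comp π) β : MeasureTheory.Measure (Literature.MathematicalPhysics.QuantumFieldTheory.GaugeConfig 4 (2 * S +
    1) H)) ((cls S) ⁻¹' {some z})).toReal - ((Literature.MathematicalPhysics.QuantumFieldTheory.wilsonMeasure
    (r.ρ.comp π) β : MeasureTheory.Measure (Literature.MathematicalPhysics.QuantumFieldTheory.GaugeConfig 4 (2 * S +
    1) H)) ((cls S) ⁻¹' {some w})).toReal| ≤ C * Real.exp (-(μ * (2 * (S : ℝ) + 1))) *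
    ((Literature.MathematicalPhysics.QuantumFieldTheory.wilsonMeasure (r.ρ.comp π) β : MeasureTheory.Measure
    (Literature.MathematicalPhysics.QuantumFieldTheory.GaugeConfig 4 (2 * S + 1) H)) ((cls S) ⁻¹' {some w})).toReal) →
    (∃ μ : ℝ, 0 < μ ∧ ∀ A : Literature.MathematicalPhysics.QuantumFieldTheory.YMSpecies G, ∃ C : ℝ, ∀ (S : ℕ) (z w :
    {p : Fin 4 × Fin 4 // p.1 < p.2} → ↥π.ker), (∀ q : {p : Fin 4 × Fin 4 // p.1 < p.2}, q.1.1 ≠ 0 → z q = w q) → |((Literature.MathematicalPhysics.QuantumFieldTheory.wilsonMeasure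
    (r.ρ.comp π) β : MeasureTheory.Measure (Literature.MathematicalPhysics.QuantumFieldTheory.GaugeConfig 4 (2 * S +
    1) H)) ((cls S) ⁻¹' {some w})).toReal * (∫ V in ((cls S) ⁻¹' {some z}), A.F (fun e => π
    (Literature.MathematicalPhysics.QuantumLattice.torusLift (2 * S + 1) V e))
    ∂(Literature.MathematicalPhysics.QuantumFieldTheory.wilsonMeasure (r.ρ.comp π) β : MeasureTheory.Measure
    (Literature.MathematicalPhysics.QuantumFieldTheory.GaugeConfig 4 (2 * S + 1) H))) -
    ((Literature.MathematicalPhysics.QuantumFieldTheory.wilsonMeasure (r.ρ.comp π) β : MeasureTheory.Measure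
    (Literature.MathematicalPhysics.QuantumFieldTheory.GaugeConfig 4 (2 * S + 1) H)) ((cls S) ⁻¹' {some z})).toReal *
    (∫ V in ((cls S) ⁻¹' {some w}), A.F (fun e => π (Literature.MathematicalPhysics.QuantumLattice.torusLift (2 * S +
    1) V e)) ∂(Literature.MathematicalPhysics.QuantumFieldTheory.wilsonMeasure (r.ρ.comp π) β : MeasureTheory.Measure
    (Literature.MathematicalPhysics.QuantumFieldTheory.GaugeConfig 4 (2 * S + 1) H)))| ≤ C * Real.exp (-(μ * (2 * (S :
    ℝ) + 1))) * ((Literature.MathematicalPhysics.QuantumFieldTheory.wilsonMeasure (r.ρ.comp π) β :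
    MeasureTheory.Measure (Literature.MathematicalPhysics.QuantumFieldTheory.GaugeConfig 4 (2 * S + 1) H)) ((cls S) ⁻¹'
    {some z})).toReal * ((Literature.MathematicalPhysics.QuantumFieldTheory.wilsonMeasure (r.ρ.comp π) β :
    MeasureTheory.Measure (Literature.MathematicalPhysics.QuantumFieldTheory.GaugeConfig 4 (2 * S + 1) H)) ((cls S) ⁻¹'
    {some w})).toReal)

/-- PSC: splitting weight + electric equipartition ⇒ per-sector clustering of pulled-back local observables, at large `β`. -/
def PerSectorClusteringOfEquipartition : Prop :=
  ∀ (G : Type) [Group G] [TopologicalSpace G] [IsTopologicalGroup G] [CompactSpace G] [MeasurableSpace G] [BorelSpace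
    G], Literature.MathematicalPhysics.QuantumFieldTheory.IsCompactSimpleLieGroup G → ∀ (H : Type) [Group H]
    [TopologicalSpace H] [IsTopologicalGroup H] [CompactSpace H] [MeasurableSpace H] [BorelSpace H],
    Literature.MathematicalPhysics.QuantumFieldTheory.IsCompactSimpleLieGroup H → SimplyConnectedSpace H → ∀ (π : H →*
    G), Continuous π → Function.Surjective π → π.ker ≤ Subgroup.center H → (π.ker : Set H).Finite → π.ker ≠ ⊥ → ∀ (ρH
    : Literature.MathematicalPhysics.QuantumFieldTheory.LatticeRep H) (r :
    Literature.MathematicalPhysics.QuantumFieldTheory.LatticeRep G), ∀ (a : ℝ) (cls : ∀ S : ℕ,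
    Literature.MathematicalPhysics.QuantumFieldTheory.GaugeConfig 4 (2 * S + 1) H → Option ({p : Fin 4 × Fin 4 // p.1
    < p.2} → ↥π.ker)), (∀ S : ℕ, ((∀ o : Option ({p : Fin 4 × Fin 4 // p.1 < p.2} → ↥π.ker), MeasurableSet ((cls S) ⁻¹'
    {o})) ∧ (∀ V : Literature.MathematicalPhysics.QuantumFieldTheory.GaugeConfig 4 (2 * S + 1) H, (cls S) V = none ↔
    (S < 64 ∨ ∃ (k : ℕ) (ch : Fin (k + 1) → Literature.MathematicalPhysics.QuantumFieldTheory.Plaquette 4 (2 * S +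
    1)), (∀ i, a ≤ (r.N : ℝ) - ((r.ρ.comp π) (Literature.MathematicalPhysics.QuantumFieldTheory.plaquetteHolonomy V
    (ch i).1 (ch i).2.1.1 (ch i).2.1.2)).trace.re) ∧ (∀ i : Fin k, (Finset.univ.sup fun j : Fin 4 => (((ch
    i.castSucc).1 j - (ch i.succ).1 j).valMinAbs).natAbs) ≤ 3) ∧ S ≤ 16 * (Finset.univ.sup fun j : Fin 4 => (((ch 0).1
    j - (ch (Fin.last k)).1 j).valMinAbs).natAbs))) ∧ (∀ (ε : Literature.MathematicalPhysics.QuantumFieldTheory.Edge 4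
    (2 * S + 1) → ↥π.ker) (V : Literature.MathematicalPhysics.QuantumFieldTheory.GaugeConfig 4 (2 * S + 1) H), (cls S)
    (fun e => ((ε e : ↥π.ker) : H) * V e) = (cls S) V) ∧ (∀ (g :
    Literature.MathematicalPhysics.QuantumFieldTheory.Site 4 (2 * S + 1) → H) (V :
    Literature.MathematicalPhysics.QuantumFieldTheory.GaugeConfig 4 (2 * S + 1) H), (cls S)
    (Literature.MathematicalPhysics.QuantumFieldTheory.gaugeTransform g V) = (cls S) V) ∧ (∀ (v :
    Literature.MathematicalPhysics.QuantumFieldTheory.Site 4 (2 * S + 1)) (V :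
    Literature.MathematicalPhysics.QuantumFieldTheory.GaugeConfig 4 (2 * S + 1) H), (cls S) (fun e => V (e.1 + v,
    e.2)) = (cls S) V) ∧ (∀ (V V' : Literature.MathematicalPhysics.QuantumFieldTheory.GaugeConfig 4 (2 * S + 1) H) (x₀
    : Literature.MathematicalPhysics.QuantumFieldTheory.Site 4 (2 * S + 1)), (∀ e :
    Literature.MathematicalPhysics.QuantumFieldTheory.Edge 4 (2 * S + 1), S < 16 * (Finset.univ.sup fun j : Fin 4 =>
    ((e.1 j - x₀ j).valMinAbs).natAbs) → V e = V' e) → (cls S) V ≠ none → (cls S) V' ≠ none → (cls S) V = (cls S) V')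
    ∧ (∀ (z : {p : Fin 4 × Fin 4 // p.1 < p.2} → ↥π.ker) (ε : Literature.MathematicalPhysics.QuantumFieldTheory.Edge 4
    (2 * S + 1) → ↥π.ker) (V : Literature.MathematicalPhysics.QuantumFieldTheory.GaugeConfig 4 (2 * S + 1) H), (∀ p :
    Literature.MathematicalPhysics.QuantumFieldTheory.Plaquette 4 (2 * S + 1), (∀ k' : H, k' ∈ π.ker → k' ≠ ((if p.1
    p.2.1.1 = 0 ∧ p.1 p.2.1.2 = 0 then ((z p.2 : ↥π.ker) : H) else (1 : H)) *
    Literature.MathematicalPhysics.QuantumFieldTheory.plaquetteHolonomy (fun e => ((ε e : ↥π.ker) : H)) p.1 p.2.1.1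
    p.2.1.2) → (ρH.ρ (k'⁻¹ * Literature.MathematicalPhysics.QuantumFieldTheory.plaquetteHolonomy V p.1 p.2.1.1
    p.2.1.2)).trace.re < (ρH.ρ ((((if p.1 p.2.1.1 = 0 ∧ p.1 p.2.1.2 = 0 then ((z p.2 : ↥π.ker) : H) else (1 : H)) *
    Literature.MathematicalPhysics.QuantumFieldTheory.plaquetteHolonomy (fun e => ((ε e : ↥π.ker) : H)) p.1 p.2.1.1
    p.2.1.2))⁻¹ * Literature.MathematicalPhysics.QuantumFieldTheory.plaquetteHolonomy V p.1 p.2.1.1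
    p.2.1.2)).trace.re)) → (cls S) V = none ∨ (cls S) V = some z) ∧ (∀ q : {p : Fin 4 × Fin 4 // p.1 < p.2}, q.1.1 ≠ 0
    → ∃ (σ : Equiv.Perm (Fin 4)) (Ψ : ({p : Fin 4 × Fin 4 // p.1 < p.2} → ↥π.ker) → ({p : Fin 4 × Fin 4 // p.1 < p.2}
    → ↥π.ker)), Function.Injective Ψ ∧ (∀ V : Literature.MathematicalPhysics.QuantumFieldTheory.GaugeConfig 4 (2 * S +
    1) H, (cls S) (Literature.MathematicalPhysics.QuantumFieldTheory.configPerm σ V) = ((cls S) V).map Ψ) ∧ (∀ z w :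
    {p : Fin 4 × Fin 4 // p.1 < p.2} → ↥π.ker, (∀ q' : {p : Fin 4 × Fin 4 // p.1 < p.2}, q' ≠ q → z q' = w q') → ∀ q''
    : {p : Fin 4 × Fin 4 // p.1 < p.2}, q''.1.1 ≠ 0 → Ψ z q'' = Ψ w q'')))) → ∀ c : ℝ, 0 < c → ∃ β_p : ℝ, ∀ β : ℝ, β_p
    ≤ β → (∃ w : H → ℝ, Continuous w ∧ (∀ h, 0 ≤ w h) ∧ (∀ h, w h⁻¹ = w h) ∧ (∀ g h, w (g * h * g⁻¹) = w h) ∧ (∀ (n :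
    ℕ) (x : Fin n → H) (v : Fin n → ℂ), 0 ≤ (∑ i, ∑ j, (starRingEnd ℂ) (v i) * v j * ((w ((x i)⁻¹ * x j) : ℝ) :
    ℂ)).re) ∧ (∀ h, ∑ᶠ k ∈ (π.ker : Set H), w (k * h) = Real.exp (β * (r.ρ (π h)).trace.re)) ∧ (∫ h in {h : H | (∀ k'
    : H, k' ∈ π.ker → k' ≠ 1 → (ρH.ρ (k'⁻¹ * h)).trace.re < (ρH.ρ h).trace.re)}, (Real.exp (β * (r.ρ (π h)).trace.re) -
    w h) ∂(Literature.MathematicalPhysics.QuantumFieldTheory.haarProbability H) ≤ Real.exp (-(c * β)) * ∫ h, w h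
    ∂(Literature.MathematicalPhysics.QuantumFieldTheory.haarProbability H))) → (∃ μ : ℝ, 0 < μ ∧ ∃ (S_e : ℕ) (C : ℝ), ∀ (S : ℕ) (z w : {p : Fin 4 × Fin 4 // p.1 < p.2} → ↥π.ker), S_e ≤ S →
    (∀ q : {p : Fin 4 × Fin 4 // p.1 < p.2}, q.1.1 ≠ 0 → z q = w q) → |((Literature.MathematicalPhysics.QuantumFieldTheory.wilsonMeasure
    (r.ρ.comp π) β : MeasureTheory.Measure (Literature.MathematicalPhysics.QuantumFieldTheory.GaugeConfig 4 (2 * S +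
    1) H)) ((cls S) ⁻¹' {some z})).toReal - ((Literature.MathematicalPhysics.QuantumFieldTheory.wilsonMeasure
    (r.ρ.comp π) β : MeasureTheory.Measure (Literature.MathematicalPhysics.QuantumFieldTheory.GaugeConfig 4 (2 * S +
    1) H)) ((cls S) ⁻¹' {some w})).toReal| ≤ C * Real.exp (-(μ * (2 * (S : ℝ) + 1))) *
    ((Literature.MathematicalPhysics.QuantumFieldTheory.wilsonMeasure (r.ρ.comp π) β : MeasureTheory.Measure
    (Literature.MathematicalPhysics.QuantumFieldTheory.GaugeConfig 4 (2 * S + 1) H)) ((cls S) ⁻¹' {some w})).toReal) →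
    (∃ m : ℝ, 0 < m ∧ ∀ A B : Literature.MathematicalPhysics.QuantumFieldTheory.YMSpecies G, ∃ C : ℝ, ∀ (S n : ℕ) (z :
    {p : Fin 4 × Fin 4 // p.1 < p.2} → ↥π.ker), n ≤ S → |(∫ V in ((cls S) ⁻¹' {some z}), A.F (fun e => π
    (Literature.MathematicalPhysics.QuantumLattice.torusLift (2 * S + 1) V e)) * B.F (fun e => π
    (Literature.MathematicalPhysics.QuantumLattice.configShift (-Pi.single 0 (n : ℤ))
    (Literature.MathematicalPhysics.QuantumLattice.torusLift (2 * S + 1) V) e))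
    ∂(Literature.MathematicalPhysics.QuantumFieldTheory.wilsonMeasure (r.ρ.comp π) β : MeasureTheory.Measure
    (Literature.MathematicalPhysics.QuantumFieldTheory.GaugeConfig 4 (2 * S + 1) H))) -
    (((Literature.MathematicalPhysics.QuantumFieldTheory.wilsonMeasure (r.ρ.comp π) β : MeasureTheory.Measure
    (Literature.MathematicalPhysics.QuantumFieldTheory.GaugeConfig 4 (2 * S + 1) H)) ((cls S) ⁻¹' {some z})).toReal)⁻¹
    * (∫ V in ((cls S) ⁻¹' {some z}), A.F (fun e => π (Literature.MathematicalPhysics.QuantumLattice.torusLift (2 * S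
    + 1) V e)) ∂(Literature.MathematicalPhysics.QuantumFieldTheory.wilsonMeasure (r.ρ.comp π) β :
    MeasureTheory.Measure (Literature.MathematicalPhysics.QuantumFieldTheory.GaugeConfig 4 (2 * S + 1) H))) * (∫ V in
    ((cls S) ⁻¹' {some z}), B.F (fun e => π (Literature.MathematicalPhysics.QuantumLattice.configShift (-Pi.single 0
    (n : ℤ)) (Literature.MathematicalPhysics.QuantumLattice.torusLift (2 * S + 1) V) e))
    ∂(Literature.MathematicalPhysics.QuantumFieldTheory.wilsonMeasure (r.ρ.comp π) β : MeasureTheory.Measure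
    (Literature.MathematicalPhysics.QuantumFieldTheory.GaugeConfig 4 (2 * S + 1) H)))| ≤ C * Real.exp (-(m * n)) *
    ((Literature.MathematicalPhysics.QuantumFieldTheory.wilsonMeasure (r.ρ.comp π) β : MeasureTheory.Measure
    (Literature.MathematicalPhysics.QuantumFieldTheory.GaugeConfig 4 (2 * S + 1) H)) ((cls S) ⁻¹' {some z})).toReal)

/-! ## §1 The registered stubs (`sorry` lives only here; signatures inline, `let`-free, fully qualified) -/

/-- **STUB WEYL — Weyl's covering theorem (COVER's published core; the TRANSFER step).** For every compact connected
topological group `G` with a faithful continuous unitary matrix representation in which every closed preconnected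
abelian normal subgroup is trivial (= compact semisimple Lie, Bröcker–tom Dieck V (3.13)), there are a compact SIMPLY
CONNECTED `H` with a faithful continuous unitary matrix representation and a continuous surjective homomorphism
`π : H →* G` with FINITE kernel — the universal covering group (Weyl: `π₁` of a compact semisimple Lie group is finite,
so the universal cover is compact; Peter–Weyl/BtD III (4.1) for linearity of `H`). Stated over Mathlib vocabulary
only. v2 (lead a1): this replaces the v1 stub `stub_universalCover`, which follows from it by the LANDED
`stub_universalCover_of_cover` (p164142: simplicity clause, centrality and non-triviality of `ker π`, Borel
σ-algebra, Hausdorffness are all derived); the instance `G = SO(3)` is LANDED unconditionally (`universalCover_SO3`,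
p163818). v2.1: the statement IS the Literature named fact `CompactSemisimpleUniversalCover` (p166348, ACCEPTED) — when its
`_holds` lands, this stub closes by name; the covering-GROUP brick is LANDED (p167119/p167209/p168289, `UniversalCoverGroup*`). The abelian Coulomb witness `U(1)` of Disproof §A3 is excluded structurally (no simply connected compact
cover with finite kernel). [difficulty L: covering-group structure + Weyl finiteness + linearity of `H` are absent from
Mathlib (~2k lines); mathematically certain; cite BrockerTomDieck1985 V (7.1), Remark (7.13), III (4.1);
Sepanski2007 Thm 1.22, Cor 6.33(a)] -/
theorem stub_weylCovering : Literature.RepresentationTheory.CompactGroups.CompactSemisimpleUniversalCover := by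
  sorry

/-- **STUB STRUCT-EXIST — the 't Hooft sector labelling exists (CONSTRUCTION; v2: existence only).** There are a badness threshold `a > 0` and, for every torus `(2S+1)⁴`, a labelling `cls_S : H^E → Option (H²-coordinates)` by the MONOPOLE-CORRECTED twist class `z ∈ (planes → ker π) ≅ H²(T⁴; π₁G)` satisfying the sector interface (measurable; unlabelled set = the explicit bad event `Bad_a,S` = `S < 64` or a chain of `a`-bad plaquettes (blind action `≥ a`) with steps `≤ 3` and extent `≥ S/16`; invariant under centre flips, gauge transformations, translations; LOCAL at scale `S/16`; normalised on clean configurations (cell labels = stack twist × coboundary); covariant under axis permutations turning any magnetic slot electric). v2 (lead a1): the v1 stub also asserted exponential rarity of the bad event; that half is LANDED cls-free (`torusBadEventRare`, p164029 — Peierls/chessboard on the odd torus transported from `(G, r)` along `π`) and is consumed directly by `coverClustering_of`; wave-1 audit found the eight clauses consistent at the constants `(64, 16, 3)` and noted that the interface forces `a ≤ a₀(H, ρH, r, π)` (harmless: `∃ a`). Construction still to do: cell labels `c_p ∈ ker π` (nearest centre translate in `Re tr ρH`), monopole current `dc`, goodness ⇒ every monopole cluster has diameter `< S/16 + 4` (each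 monopole cube has an `a`-bad face for `a ≤ a₀` by the Bianchi identity), local fillings in balls (`ker π`-valued compact-support degree-3 Poincaré lemma on the 4-torus — tree has the ℤ-valued `LatticeForm`/`LatticeChain` pieces only), corrected closed cochain, fluxes through the six coordinate 2-tori. [difficulty L; classical; DeforcrandJahn2003 §2, MackPetkova1980, tHooft1979Flux] -/
theorem stub_sectorLabelling : ∀ (G : Type) [Group G] [TopologicalSpace G] [IsTopologicalGroup G] [CompactSpace G] [MeasurableSpace G] [BorelSpace
    G], Literature.MathematicalPhysics.QuantumFieldTheory.IsCompactSimpleLieGroup G → ∀ (H : Type) [Group H]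
    [TopologicalSpace H] [IsTopologicalGroup H] [CompactSpace H] [MeasurableSpace H] [BorelSpace H],
    Literature.MathematicalPhysics.QuantumFieldTheory.IsCompactSimpleLieGroup H → SimplyConnectedSpace H → ∀ (π : H →*
    G), Continuous π → Function.Surjective π → π.ker ≤ Subgroup.center H → (π.ker : Set H).Finite → π.ker ≠ ⊥ → ∀ (ρH
    : Literature.MathematicalPhysics.QuantumFieldTheory.LatticeRep H) (r :
    Literature.MathematicalPhysics.QuantumFieldTheory.LatticeRep G), ∃ a : ℝ, 0 < a ∧ ∃ cls : (∀ S : ℕ,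
    Literature.MathematicalPhysics.QuantumFieldTheory.GaugeConfig 4 (2 * S + 1) H → Option ({p : Fin 4 × Fin 4 // p.1
    < p.2} → ↥π.ker)), (∀ S : ℕ, ((∀ o : Option ({p : Fin 4 × Fin 4 // p.1 < p.2} → ↥π.ker), MeasurableSet ((cls S) ⁻¹'
    {o})) ∧ (∀ V : Literature.MathematicalPhysics.QuantumFieldTheory.GaugeConfig 4 (2 * S + 1) H, (cls S) V = none ↔
    (S < 64 ∨ ∃ (k : ℕ) (ch : Fin (k + 1) → Literature.MathematicalPhysics.QuantumFieldTheory.Plaquette 4 (2 * S +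
    1)), (∀ i, a ≤ (r.N : ℝ) - ((r.ρ.comp π) (Literature.MathematicalPhysics.QuantumFieldTheory.plaquetteHolonomy V
    (ch i).1 (ch i).2.1.1 (ch i).2.1.2)).trace.re) ∧ (∀ i : Fin k, (Finset.univ.sup fun j : Fin 4 => (((ch
    i.castSucc).1 j - (ch i.succ).1 j).valMinAbs).natAbs) ≤ 3) ∧ S ≤ 16 * (Finset.univ.sup fun j : Fin 4 => (((ch 0).1
    j - (ch (Fin.last k)).1 j).valMinAbs).natAbs))) ∧ (∀ (ε : Literature.MathematicalPhysics.QuantumFieldTheory.Edge 4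
    (2 * S + 1) → ↥π.ker) (V : Literature.MathematicalPhysics.QuantumFieldTheory.GaugeConfig 4 (2 * S + 1) H), (cls S)
    (fun e => ((ε e : ↥π.ker) : H) * V e) = (cls S) V) ∧ (∀ (g :
    Literature.MathematicalPhysics.QuantumFieldTheory.Site 4 (2 * S + 1) → H) (V :
    Literature.MathematicalPhysics.QuantumFieldTheory.GaugeConfig 4 (2 * S + 1) H), (cls S)
    (Literature.MathematicalPhysics.QuantumFieldTheory.gaugeTransform g V) = (cls S) V) ∧ (∀ (v :
    Literature.MathematicalPhysics.QuantumFieldTheory.Site 4 (2 * S + 1)) (V :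
    Literature.MathematicalPhysics.QuantumFieldTheory.GaugeConfig 4 (2 * S + 1) H), (cls S) (fun e => V (e.1 + v,
    e.2)) = (cls S) V) ∧ (∀ (V V' : Literature.MathematicalPhysics.QuantumFieldTheory.GaugeConfig 4 (2 * S + 1) H) (x₀
    : Literature.MathematicalPhysics.QuantumFieldTheory.Site 4 (2 * S + 1)), (∀ e :
    Literature.MathematicalPhysics.QuantumFieldTheory.Edge 4 (2 * S + 1), S < 16 * (Finset.univ.sup fun j : Fin 4 =>
    ((e.1 j - x₀ j).valMinAbs).natAbs) → V e = V' e) → (cls S) V ≠ none → (cls S) V' ≠ none → (cls S) V = (cls S) V')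
    ∧ (∀ (z : {p : Fin 4 × Fin 4 // p.1 < p.2} → ↥π.ker) (ε : Literature.MathematicalPhysics.QuantumFieldTheory.Edge 4
    (2 * S + 1) → ↥π.ker) (V : Literature.MathematicalPhysics.QuantumFieldTheory.GaugeConfig 4 (2 * S + 1) H), (∀ p :
    Literature.MathematicalPhysics.QuantumFieldTheory.Plaquette 4 (2 * S + 1), (∀ k' : H, k' ∈ π.ker → k' ≠ ((if p.1
    p.2.1.1 = 0 ∧ p.1 p.2.1.2 = 0 then ((z p.2 : ↥π.ker) : H) else (1 : H)) *
    Literature.MathematicalPhysics.QuantumFieldTheory.plaquetteHolonomy (fun e => ((ε e : ↥π.ker) : H)) p.1 p.2.1.1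
    p.2.1.2) → (ρH.ρ (k'⁻¹ * Literature.MathematicalPhysics.QuantumFieldTheory.plaquetteHolonomy V p.1 p.2.1.1
    p.2.1.2)).trace.re < (ρH.ρ ((((if p.1 p.2.1.1 = 0 ∧ p.1 p.2.1.2 = 0 then ((z p.2 : ↥π.ker) : H) else (1 : H)) *
    Literature.MathematicalPhysics.QuantumFieldTheory.plaquetteHolonomy (fun e => ((ε e : ↥π.ker) : H)) p.1 p.2.1.1
    p.2.1.2))⁻¹ * Literature.MathematicalPhysics.QuantumFieldTheory.plaquetteHolonomy V p.1 p.2.1.1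
    p.2.1.2)).trace.re)) → (cls S) V = none ∨ (cls S) V = some z) ∧ (∀ q : {p : Fin 4 × Fin 4 // p.1 < p.2}, q.1.1 ≠ 0
    → ∃ (σ : Equiv.Perm (Fin 4)) (Ψ : ({p : Fin 4 × Fin 4 // p.1 < p.2} → ↥π.ker) → ({p : Fin 4 × Fin 4 // p.1 < p.2}
    → ↥π.ker)), Function.Injective Ψ ∧ (∀ V : Literature.MathematicalPhysics.QuantumFieldTheory.GaugeConfig 4 (2 * S +
    1) H, (cls S) (Literature.MathematicalPhysics.QuantumFieldTheory.configPerm σ V) = ((cls S) V).map Ψ) ∧ (∀ z w :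
    {p : Fin 4 × Fin 4 // p.1 < p.2} → ↥π.ker, (∀ q' : {p : Fin 4 × Fin 4 // p.1 < p.2}, q' ≠ q → z q' = w q') → ∀ q''
    : {p : Fin 4 × Fin 4 // p.1 < p.2}, q''.1.1 ≠ 0 → Ψ z q'' = Ψ w q'')))) := by
  sorry

/-- **STUB EQUI — electric twist equipartition (the card's `TwistEquipartition`, confinement-lite; the π₁-specific physical input and the line's kill criterion).** At large `β`, on the symmetric tori `(2S+1)⁴`, sector weights differing only in ELECTRIC slots (planes containing the time axis `0`) agree up to a factor `1 ± C e^{−μ(2S+1)}`: `|p_z − p_w| ≤ C e^{−μ(2S+1)} p_w`. In 't Hooft's language: the electric-flux free energies grow at least linearly, `F_el ≥ μL − C` (weaker than the area law `σL²` of the confinement criterion; any massive phase with unbroken centre flux symmetry has it). False exactly in a Coulomb / zero-temperature-deconfined phase of 4-d `SO(3)`-type Yang–Mills at arbitrarily large `β` — where the crux is false too. `FiniteTemperatureDeconfinement` does not bite: `N_t = N_s = 2S+1`, `S` after `β`. [difficulty: open-problem-hard; sources tHooft1979Flux §§6–7, TomboulisYaffe1985, DeforcrandJahn2003 §6, KovacsTomboulis2000]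 -/
theorem stub_twistEquipartition : ∀ (G : Type) [Group G] [TopologicalSpace G] [IsTopologicalGroup G] [CompactSpace G] [MeasurableSpace G] [BorelSpace
    G], Literature.MathematicalPhysics.QuantumFieldTheory.IsCompactSimpleLieGroup G → ∀ (H : Type) [Group H]
    [TopologicalSpace H] [IsTopologicalGroup H] [CompactSpace H] [MeasurableSpace H] [BorelSpace H],
    Literature.MathematicalPhysics.QuantumFieldTheory.IsCompactSimpleLieGroup H → SimplyConnectedSpace H → ∀ (π : H →*
    G), Continuous π → Function.Surjective π → π.ker ≤ Subgroup.center H → (π.ker : Set H).Finite → π.ker ≠ ⊥ → ∀ (ρH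
    : Literature.MathematicalPhysics.QuantumFieldTheory.LatticeRep H) (r :
    Literature.MathematicalPhysics.QuantumFieldTheory.LatticeRep G), ∀ (a : ℝ) (cls : ∀ S : ℕ,
    Literature.MathematicalPhysics.QuantumFieldTheory.GaugeConfig 4 (2 * S + 1) H → Option ({p : Fin 4 × Fin 4 // p.1
    < p.2} → ↥π.ker)), (∀ S : ℕ, ((∀ o : Option ({p : Fin 4 × Fin 4 // p.1 < p.2} → ↥π.ker), MeasurableSet ((cls S) ⁻¹'
    {o})) ∧ (∀ V : Literature.MathematicalPhysics.QuantumFieldTheory.GaugeConfig 4 (2 * S + 1) H, (cls S) V = none ↔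
    (S < 64 ∨ ∃ (k : ℕ) (ch : Fin (k + 1) → Literature.MathematicalPhysics.QuantumFieldTheory.Plaquette 4 (2 * S +
    1)), (∀ i, a ≤ (r.N : ℝ) - ((r.ρ.comp π) (Literature.MathematicalPhysics.QuantumFieldTheory.plaquetteHolonomy V
    (ch i).1 (ch i).2.1.1 (ch i).2.1.2)).trace.re) ∧ (∀ i : Fin k, (Finset.univ.sup fun j : Fin 4 => (((ch
    i.castSucc).1 j - (ch i.succ).1 j).valMinAbs).natAbs) ≤ 3) ∧ S ≤ 16 * (Finset.univ.sup fun j : Fin 4 => (((ch 0).1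
    j - (ch (Fin.last k)).1 j).valMinAbs).natAbs))) ∧ (∀ (ε : Literature.MathematicalPhysics.QuantumFieldTheory.Edge 4
    (2 * S + 1) → ↥π.ker) (V : Literature.MathematicalPhysics.QuantumFieldTheory.GaugeConfig 4 (2 * S + 1) H), (cls S)
    (fun e => ((ε e : ↥π.ker) : H) * V e) = (cls S) V) ∧ (∀ (g :
    Literature.MathematicalPhysics.QuantumFieldTheory.Site 4 (2 * S + 1) → H) (V :
    Literature.MathematicalPhysics.QuantumFieldTheory.GaugeConfig 4 (2 * S + 1) H), (cls S)
    (Literature.MathematicalPhysics.QuantumFieldTheory.gaugeTransform g V) = (cls S) V) ∧ (∀ (v :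
    Literature.MathematicalPhysics.QuantumFieldTheory.Site 4 (2 * S + 1)) (V :
    Literature.MathematicalPhysics.QuantumFieldTheory.GaugeConfig 4 (2 * S + 1) H), (cls S) (fun e => V (e.1 + v,
    e.2)) = (cls S) V) ∧ (∀ (V V' : Literature.MathematicalPhysics.QuantumFieldTheory.GaugeConfig 4 (2 * S + 1) H) (x₀
    : Literature.MathematicalPhysics.QuantumFieldTheory.Site 4 (2 * S + 1)), (∀ e :
    Literature.MathematicalPhysics.QuantumFieldTheory.Edge 4 (2 * S + 1), S < 16 * (Finset.univ.sup fun j : Fin 4 =>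
    ((e.1 j - x₀ j).valMinAbs).natAbs) → V e = V' e) → (cls S) V ≠ none → (cls S) V' ≠ none → (cls S) V = (cls S) V')
    ∧ (∀ (z : {p : Fin 4 × Fin 4 // p.1 < p.2} → ↥π.ker) (ε : Literature.MathematicalPhysics.QuantumFieldTheory.Edge 4
    (2 * S + 1) → ↥π.ker) (V : Literature.MathematicalPhysics.QuantumFieldTheory.GaugeConfig 4 (2 * S + 1) H), (∀ p :
    Literature.MathematicalPhysics.QuantumFieldTheory.Plaquette 4 (2 * S + 1), (∀ k' : H, k' ∈ π.ker → k' ≠ ((if p.1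
    p.2.1.1 = 0 ∧ p.1 p.2.1.2 = 0 then ((z p.2 : ↥π.ker) : H) else (1 : H)) *
    Literature.MathematicalPhysics.QuantumFieldTheory.plaquetteHolonomy (fun e => ((ε e : ↥π.ker) : H)) p.1 p.2.1.1
    p.2.1.2) → (ρH.ρ (k'⁻¹ * Literature.MathematicalPhysics.QuantumFieldTheory.plaquetteHolonomy V p.1 p.2.1.1
    p.2.1.2)).trace.re < (ρH.ρ ((((if p.1 p.2.1.1 = 0 ∧ p.1 p.2.1.2 = 0 then ((z p.2 : ↥π.ker) : H) else (1 : H)) *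
    Literature.MathematicalPhysics.QuantumFieldTheory.plaquetteHolonomy (fun e => ((ε e : ↥π.ker) : H)) p.1 p.2.1.1
    p.2.1.2))⁻¹ * Literature.MathematicalPhysics.QuantumFieldTheory.plaquetteHolonomy V p.1 p.2.1.1
    p.2.1.2)).trace.re)) → (cls S) V = none ∨ (cls S) V = some z) ∧ (∀ q : {p : Fin 4 × Fin 4 // p.1 < p.2}, q.1.1 ≠ 0
    → ∃ (σ : Equiv.Perm (Fin 4)) (Ψ : ({p : Fin 4 × Fin 4 // p.1 < p.2} → ↥π.ker) → ({p : Fin 4 × Fin 4 // p.1 < p.2}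
    → ↥π.ker)), Function.Injective Ψ ∧ (∀ V : Literature.MathematicalPhysics.QuantumFieldTheory.GaugeConfig 4 (2 * S +
    1) H, (cls S) (Literature.MathematicalPhysics.QuantumFieldTheory.configPerm σ V) = ((cls S) V).map Ψ) ∧ (∀ z w :
    {p : Fin 4 × Fin 4 // p.1 < p.2} → ↥π.ker, (∀ q' : {p : Fin 4 × Fin 4 // p.1 < p.2}, q' ≠ q → z q' = w q') → ∀ q''
    : {p : Fin 4 × Fin 4 // p.1 < p.2}, q''.1.1 ≠ 0 → Ψ z q'' = Ψ w q'')))) → ∃ β_e : ℝ, ∀ β : ℝ, β_e ≤ β → (∃ μ : ℝ, 0 < μ ∧ ∃ (S_e : ℕ) (C : ℝ), ∀ (S : ℕ) (z w : {p : Fin 4 × Fin 4 // p.1 < p.2} → ↥π.ker), S_e ≤ S →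
    (∀ q : {p : Fin 4 × Fin 4 // p.1 < p.2}, q.1.1 ≠ 0 → z q = w q) → |((Literature.MathematicalPhysics.QuantumFieldTheory.wilsonMeasure (r.ρ.comp π) β :
    MeasureTheory.Measure (Literature.MathematicalPhysics.QuantumFieldTheory.GaugeConfig 4 (2 * S + 1) H)) ((cls S) ⁻¹'
    {some z})).toReal - ((Literature.MathematicalPhysics.QuantumFieldTheory.wilsonMeasure (r.ρ.comp π) β :
    MeasureTheory.Measure (Literature.MathematicalPhysics.QuantumFieldTheory.GaugeConfig 4 (2 * S + 1) H)) ((cls S) ⁻¹'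
    {some w})).toReal| ≤ C * Real.exp (-(μ * (2 * (S : ℝ) + 1))) *
    ((Literature.MathematicalPhysics.QuantumFieldTheory.wilsonMeasure (r.ρ.comp π) β : MeasureTheory.Measure
    (Literature.MathematicalPhysics.QuantumFieldTheory.GaugeConfig 4 (2 * S + 1) H)) ((cls S) ⁻¹' {some w})).toReal) := by
  sorry

/-- **STUB SPLIT — the positive-type centre-sensitive splitting of the centre-blind Wilson weight (triage S1, the Bessel cell; removes the card's NEG).** At large `β` there is a continuous class function `w ≥ 0` on `H`, positive definite (so reflection positivity / a PSD transfer operator survive — barrier `ImprovedActionPositivityViolation` evaded), with `Σ_{k ∈ ker π} w(kh) = exp(β Re tr r(π h))` EXACTLY and exponentially small label noise: the `w`-mass of the wrong cells, `∫_{cell(1)} (e^{β Re tr r(π h)} − w(h)) dh ≤ e^{−cβ} ∫ w`. For `SU(2) → SO(3)`: `w_B = ½ Σ_{j ∈ ½ℕ} e^β (I_j(2β) − I_{j+1}(2β)) χ_j` (the weight's own Bessel character formula continued to half-integer spin; all coefficients `> 0` since `I_ν` decreases in `ν`; noise ratio `≤ ½e^{−4β}`, triage toy C). General `(H, ker π)`: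 continue the generalised-Bessel character coefficients of `e^{β Re χ_{r∘π}}` to `ker π`-charged dominant weights — the one structural bet, cheap numerics per group. [difficulty M; harmonic analysis] -/
theorem stub_centreSplitting : ∀ (G : Type) [Group G] [TopologicalSpace G] [IsTopologicalGroup G] [CompactSpace G] [MeasurableSpace G] [BorelSpace
    G], Literature.MathematicalPhysics.QuantumFieldTheory.IsCompactSimpleLieGroup G → ∀ (H : Type) [Group H]
    [TopologicalSpace H] [IsTopologicalGroup H] [CompactSpace H] [MeasurableSpace H] [BorelSpace H],
    Literature.MathematicalPhysics.QuantumFieldTheory.IsCompactSimpleLieGroup H → SimplyConnectedSpace H → ∀ (π : H →*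
    G), Continuous π → Function.Surjective π → π.ker ≤ Subgroup.center H → (π.ker : Set H).Finite → π.ker ≠ ⊥ → ∀ (ρH
    : Literature.MathematicalPhysics.QuantumFieldTheory.LatticeRep H) (r :
    Literature.MathematicalPhysics.QuantumFieldTheory.LatticeRep G), ∃ c : ℝ, 0 < c ∧ ∃ β_s : ℝ, ∀ β : ℝ, β_s ≤ β → (∃
    w : H → ℝ, Continuous w ∧ (∀ h, 0 ≤ w h) ∧ (∀ h, w h⁻¹ = w h) ∧ (∀ g h, w (g * h * g⁻¹) = w h) ∧ (∀ (n : ℕ) (x :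
    Fin n → H) (v : Fin n → ℂ), 0 ≤ (∑ i, ∑ j, (starRingEnd ℂ) (v i) * v j * ((w ((x i)⁻¹ * x j) : ℝ) : ℂ)).re) ∧ (∀
    h, ∑ᶠ k ∈ (π.ker : Set H), w (k * h) = Real.exp (β * (r.ρ (π h)).trace.re)) ∧ (∫ h in {h : H | (∀ k' : H, k' ∈
    π.ker → k' ≠ 1 → (ρH.ρ (k'⁻¹ * h)).trace.re < (ρH.ρ h).trace.re)}, (Real.exp (β * (r.ρ (π h)).trace.re) - w h)
    ∂(Literature.MathematicalPhysics.QuantumFieldTheory.haarProbability H) ≤ Real.exp (-(c * β)) * ∫ h, w h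
    ∂(Literature.MathematicalPhysics.QuantumFieldTheory.haarProbability H))) := by
  sorry

/-- **STUB EBLIND — electric blindness from equipartition (card (III): 't Hooft's `ker π`-Fourier duality run with the centre-SENSITIVE PSD transfer operator of SPLIT, robust to dilute defects = triage S2).** Given the splitting weight `w` (noise `e^{−cβ}`) and electric equipartition, local pulled-back observables have sector means that agree across electrically related sectors up to `C_A e^{−μ'(2S+1)}`: `|p_w ∫_{E_z} Ã − p_z ∫_{E_w} Ã| ≤ C e^{−μ'(2S+1)} p_z p_w`. Mechanism: in the joint `(V, α)` representation (`α` the `ker π`-valued label field of the exact mixture `Π_p Σ_{α_p} w(α_p V_p)`), gauge `α ≡ 1` on the temporal plaquettes of steps `0 … L−2`; the electric coordinates of the corrected class are the `ker π`-holonomies of the last step's labels (times LOCALISED flip insertions at the dilute defects); `p_{(m,k)} Z ∝ Σ_e χ_e(k) Z_{m,e}`, `E[Ã; E_{(m,k)}] Z ∝ Σ_e χ_e(k) tr_{m,e}(𝕋^L Â)`, Fourier inversion turns equipartition into `|Z_{m,e≠0}| ≤ C e^{−μL} Z_{m,0}` and positivity of `𝕋` (SPLIT) gives `|tr_{m,e}(𝕋^L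 Â)| ≤ ‖A‖ Z_{m,e}`. The honest residual (triage (b)/S2): the trace inequalities must be shown robust to the typical (`≈ e^{−cβ}L³` per slab) localised defect insertions. [difficulty L; the line's new mechanism] -/
theorem stub_electricBlindness : ∀ (G : Type) [Group G] [TopologicalSpace G] [IsTopologicalGroup G] [CompactSpace G] [MeasurableSpace G] [BorelSpace
    G], Literature.MathematicalPhysics.QuantumFieldTheory.IsCompactSimpleLieGroup G → ∀ (H : Type) [Group H]
    [TopologicalSpace H] [IsTopologicalGroup H] [CompactSpace H] [MeasurableSpace H] [BorelSpace H],
    Literature.MathematicalPhysics.QuantumFieldTheory.IsCompactSimpleLieGroup H → SimplyConnectedSpace H → ∀ (π : H →*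
    G), Continuous π → Function.Surjective π → π.ker ≤ Subgroup.center H → (π.ker : Set H).Finite → π.ker ≠ ⊥ → ∀ (ρH
    : Literature.MathematicalPhysics.QuantumFieldTheory.LatticeRep H) (r :
    Literature.MathematicalPhysics.QuantumFieldTheory.LatticeRep G), ∀ (a : ℝ) (cls : ∀ S : ℕ,
    Literature.MathematicalPhysics.QuantumFieldTheory.GaugeConfig 4 (2 * S + 1) H → Option ({p : Fin 4 × Fin 4 // p.1
    < p.2} → ↥π.ker)), (∀ S : ℕ, ((∀ o : Option ({p : Fin 4 × Fin 4 // p.1 < p.2} → ↥π.ker), MeasurableSet ((cls S) ⁻¹'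
    {o})) ∧ (∀ V : Literature.MathematicalPhysics.QuantumFieldTheory.GaugeConfig 4 (2 * S + 1) H, (cls S) V = none ↔
    (S < 64 ∨ ∃ (k : ℕ) (ch : Fin (k + 1) → Literature.MathematicalPhysics.QuantumFieldTheory.Plaquette 4 (2 * S +
    1)), (∀ i, a ≤ (r.N : ℝ) - ((r.ρ.comp π) (Literature.MathematicalPhysics.QuantumFieldTheory.plaquetteHolonomy V
    (ch i).1 (ch i).2.1.1 (ch i).2.1.2)).trace.re) ∧ (∀ i : Fin k, (Finset.univ.sup fun j : Fin 4 => (((ch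
    i.castSucc).1 j - (ch i.succ).1 j).valMinAbs).natAbs) ≤ 3) ∧ S ≤ 16 * (Finset.univ.sup fun j : Fin 4 => (((ch 0).1
    j - (ch (Fin.last k)).1 j).valMinAbs).natAbs))) ∧ (∀ (ε : Literature.MathematicalPhysics.QuantumFieldTheory.Edge 4
    (2 * S + 1) → ↥π.ker) (V : Literature.MathematicalPhysics.QuantumFieldTheory.GaugeConfig 4 (2 * S + 1) H), (cls S)
    (fun e => ((ε e : ↥π.ker) : H) * V e) = (cls S) V) ∧ (∀ (g :
    Literature.MathematicalPhysics.QuantumFieldTheory.Site 4 (2 * S + 1) → H) (V :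
    Literature.MathematicalPhysics.QuantumFieldTheory.GaugeConfig 4 (2 * S + 1) H), (cls S)
    (Literature.MathematicalPhysics.QuantumFieldTheory.gaugeTransform g V) = (cls S) V) ∧ (∀ (v :
    Literature.MathematicalPhysics.QuantumFieldTheory.Site 4 (2 * S + 1)) (V :
    Literature.MathematicalPhysics.QuantumFieldTheory.GaugeConfig 4 (2 * S + 1) H), (cls S) (fun e => V (e.1 + v,
    e.2)) = (cls S) V) ∧ (∀ (V V' : Literature.MathematicalPhysics.QuantumFieldTheory.GaugeConfig 4 (2 * S + 1) H) (x₀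
    : Literature.MathematicalPhysics.QuantumFieldTheory.Site 4 (2 * S + 1)), (∀ e :
    Literature.MathematicalPhysics.QuantumFieldTheory.Edge 4 (2 * S + 1), S < 16 * (Finset.univ.sup fun j : Fin 4 =>
    ((e.1 j - x₀ j).valMinAbs).natAbs) → V e = V' e) → (cls S) V ≠ none → (cls S) V' ≠ none → (cls S) V = (cls S) V')
    ∧ (∀ (z : {p : Fin 4 × Fin 4 // p.1 < p.2} → ↥π.ker) (ε : Literature.MathematicalPhysics.QuantumFieldTheory.Edge 4
    (2 * S + 1) → ↥π.ker) (V : Literature.MathematicalPhysics.QuantumFieldTheory.GaugeConfig 4 (2 * S + 1) H), (∀ p :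
    Literature.MathematicalPhysics.QuantumFieldTheory.Plaquette 4 (2 * S + 1), (∀ k' : H, k' ∈ π.ker → k' ≠ ((if p.1
    p.2.1.1 = 0 ∧ p.1 p.2.1.2 = 0 then ((z p.2 : ↥π.ker) : H) else (1 : H)) *
    Literature.MathematicalPhysics.QuantumFieldTheory.plaquetteHolonomy (fun e => ((ε e : ↥π.ker) : H)) p.1 p.2.1.1
    p.2.1.2) → (ρH.ρ (k'⁻¹ * Literature.MathematicalPhysics.QuantumFieldTheory.plaquetteHolonomy V p.1 p.2.1.1
    p.2.1.2)).trace.re < (ρH.ρ ((((if p.1 p.2.1.1 = 0 ∧ p.1 p.2.1.2 = 0 then ((z p.2 : ↥π.ker) : H) else (1 : H)) *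
    Literature.MathematicalPhysics.QuantumFieldTheory.plaquetteHolonomy (fun e => ((ε e : ↥π.ker) : H)) p.1 p.2.1.1
    p.2.1.2))⁻¹ * Literature.MathematicalPhysics.QuantumFieldTheory.plaquetteHolonomy V p.1 p.2.1.1
    p.2.1.2)).trace.re)) → (cls S) V = none ∨ (cls S) V = some z) ∧ (∀ q : {p : Fin 4 × Fin 4 // p.1 < p.2}, q.1.1 ≠ 0
    → ∃ (σ : Equiv.Perm (Fin 4)) (Ψ : ({p : Fin 4 × Fin 4 // p.1 < p.2} → ↥π.ker) → ({p : Fin 4 × Fin 4 // p.1 < p.2}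
    → ↥π.ker)), Function.Injective Ψ ∧ (∀ V : Literature.MathematicalPhysics.QuantumFieldTheory.GaugeConfig 4 (2 * S +
    1) H, (cls S) (Literature.MathematicalPhysics.QuantumFieldTheory.configPerm σ V) = ((cls S) V).map Ψ) ∧ (∀ z w :
    {p : Fin 4 × Fin 4 // p.1 < p.2} → ↥π.ker, (∀ q' : {p : Fin 4 × Fin 4 // p.1 < p.2}, q' ≠ q → z q' = w q') → ∀ q''
    : {p : Fin 4 × Fin 4 // p.1 < p.2}, q''.1.1 ≠ 0 → Ψ z q'' = Ψ w q'')))) → ∀ c : ℝ, 0 < c → ∃ β_b : ℝ, ∀ β : ℝ, β_b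
    ≤ β → (∃ w : H → ℝ, Continuous w ∧ (∀ h, 0 ≤ w h) ∧ (∀ h, w h⁻¹ = w h) ∧ (∀ g h, w (g * h * g⁻¹) = w h) ∧ (∀ (n :
    ℕ) (x : Fin n → H) (v : Fin n → ℂ), 0 ≤ (∑ i, ∑ j, (starRingEnd ℂ) (v i) * v j * ((w ((x i)⁻¹ * x j) : ℝ) :
    ℂ)).re) ∧ (∀ h, ∑ᶠ k ∈ (π.ker : Set H), w (k * h) = Real.exp (β * (r.ρ (π h)).trace.re)) ∧ (∫ h in {h : H | (∀ k'
    : H, k' ∈ π.ker → k' ≠ 1 → (ρH.ρ (k'⁻¹ * h)).trace.re < (ρH.ρ h).trace.re)}, (Real.exp (β * (r.ρ (π h)).trace.re) -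
    w h) ∂(Literature.MathematicalPhysics.QuantumFieldTheory.haarProbability H) ≤ Real.exp (-(c * β)) * ∫ h, w h
    ∂(Literature.MathematicalPhysics.QuantumFieldTheory.haarProbability H))) → (∃ μ : ℝ, 0 < μ ∧ ∃ (S_e : ℕ) (C : ℝ), ∀ (S : ℕ) (z w : {p : Fin 4 × Fin 4 // p.1 < p.2} → ↥π.ker), S_e ≤ S →
    (∀ q : {p : Fin 4 × Fin 4 // p.1 < p.2}, q.1.1 ≠ 0 → z q = w q) → |((Literature.MathematicalPhysics.QuantumFieldTheory.wilsonMeasure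
    (r.ρ.comp π) β : MeasureTheory.Measure (Literature.MathematicalPhysics.QuantumFieldTheory.GaugeConfig 4 (2 * S +
    1) H)) ((cls S) ⁻¹' {some z})).toReal - ((Literature.MathematicalPhysics.QuantumFieldTheory.wilsonMeasure
    (r.ρ.comp π) β : MeasureTheory.Measure (Literature.MathematicalPhysics.QuantumFieldTheory.GaugeConfig 4 (2 * S +
    1) H)) ((cls S) ⁻¹' {some w})).toReal| ≤ C * Real.exp (-(μ * (2 * (S : ℝ) + 1))) *
    ((Literature.MathematicalPhysics.QuantumFieldTheory.wilsonMeasure (r.ρ.comp π) β : MeasureTheory.Measure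
    (Literature.MathematicalPhysics.QuantumFieldTheory.GaugeConfig 4 (2 * S + 1) H)) ((cls S) ⁻¹' {some w})).toReal) →
    (∃ μ : ℝ, 0 < μ ∧ ∀ A : Literature.MathematicalPhysics.QuantumFieldTheory.YMSpecies G, ∃ C : ℝ, ∀ (S : ℕ) (z w :
    {p : Fin 4 × Fin 4 // p.1 < p.2} → ↥π.ker), (∀ q : {p : Fin 4 × Fin 4 // p.1 < p.2}, q.1.1 ≠ 0 → z q = w q) → |((Literature.MathematicalPhysics.QuantumFieldTheory.wilsonMeasure
    (r.ρ.comp π) β : MeasureTheory.Measure (Literature.MathematicalPhysics.QuantumFieldTheory.GaugeConfig 4 (2 * S +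
    1) H)) ((cls S) ⁻¹' {some w})).toReal * (∫ V in ((cls S) ⁻¹' {some z}), A.F (fun e => π
    (Literature.MathematicalPhysics.QuantumLattice.torusLift (2 * S + 1) V e))
    ∂(Literature.MathematicalPhysics.QuantumFieldTheory.wilsonMeasure (r.ρ.comp π) β : MeasureTheory.Measure
    (Literature.MathematicalPhysics.QuantumFieldTheory.GaugeConfig 4 (2 * S + 1) H))) -
    ((Literature.MathematicalPhysics.QuantumFieldTheory.wilsonMeasure (r.ρ.comp π) β : MeasureTheory.Measure
    (Literature.MathematicalPhysics.QuantumFieldTheory.GaugeConfig 4 (2 * S + 1) H)) ((cls S) ⁻¹' {some z})).toReal *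
    (∫ V in ((cls S) ⁻¹' {some w}), A.F (fun e => π (Literature.MathematicalPhysics.QuantumLattice.torusLift (2 * S +
    1) V e)) ∂(Literature.MathematicalPhysics.QuantumFieldTheory.wilsonMeasure (r.ρ.comp π) β : MeasureTheory.Measure
    (Literature.MathematicalPhysics.QuantumFieldTheory.GaugeConfig 4 (2 * S + 1) H)))| ≤ C * Real.exp (-(μ * (2 * (S :
    ℝ) + 1))) * ((Literature.MathematicalPhysics.QuantumFieldTheory.wilsonMeasure (r.ρ.comp π) β :
    MeasureTheory.Measure (Literature.MathematicalPhysics.QuantumFieldTheory.GaugeConfig 4 (2 * S + 1) H)) ((cls S) ⁻¹'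
    {some z})).toReal * ((Literature.MathematicalPhysics.QuantumFieldTheory.wilsonMeasure (r.ρ.comp π) β :
    MeasureTheory.Measure (Literature.MathematicalPhysics.QuantumFieldTheory.GaugeConfig 4 (2 * S + 1) H)) ((cls S) ⁻¹'
    {some w})).toReal) := by
  sorry

/-- **STUB PSC — per-sector clustering (the crux-sized core, stated per triage S3: GIVEN the splitting weight and electric equipartition).** Inside every sector `E_z` of every interface labelling, pulled-back local observables cluster in time at a volume-uniform rate: `|∫_{E_z} ÃB̃_n − p_z⁻¹ ∫_{E_z} Ã ∫_{E_z} B̃_n| ≤ C_{A,B} e^{−mn} p_z` for `n ≤ S` (junk-safe at `p_z = 0`). With electric suppression this is clustering of the `e = 0` block of `P_m 𝕋` — a genuine spectral-gap statement for the simply connected cover theory in a FIXED magnetic flux sector, where the slice bottleneck that created this crux is absent (the witness of `BrascampLiebVacuum/Negative/FalseOfSliceBottleneck` interpolates BETWEEN sectors and is a.s. constant inside one); the route's K1-conditioned / K2 / K3 machinery is meant to run per sector, with the twisted sector's flat background subtracted from the `p = 0` covariance (card (4)). It is NOT the crux restated: different measure (conditioned), simply connected group, and it consumes equipartition. [difficulty: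 open-problem (weak-coupling gap); the hardest stub] -/
theorem stub_perSectorClustering : ∀ (G : Type) [Group G] [TopologicalSpace G] [IsTopologicalGroup G] [CompactSpace G] [MeasurableSpace G] [BorelSpace
    G], Literature.MathematicalPhysics.QuantumFieldTheory.IsCompactSimpleLieGroup G → ∀ (H : Type) [Group H]
    [TopologicalSpace H] [IsTopologicalGroup H] [CompactSpace H] [MeasurableSpace H] [BorelSpace H],
    Literature.MathematicalPhysics.QuantumFieldTheory.IsCompactSimpleLieGroup H → SimplyConnectedSpace H → ∀ (π : H →*
    G), Continuous π → Function.Surjective π → π.ker ≤ Subgroup.center H → (π.ker : Set H).Finite → π.ker ≠ ⊥ → ∀ (ρH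
    : Literature.MathematicalPhysics.QuantumFieldTheory.LatticeRep H) (r :
    Literature.MathematicalPhysics.QuantumFieldTheory.LatticeRep G), ∀ (a : ℝ) (cls : ∀ S : ℕ,
    Literature.MathematicalPhysics.QuantumFieldTheory.GaugeConfig 4 (2 * S + 1) H → Option ({p : Fin 4 × Fin 4 // p.1
    < p.2} → ↥π.ker)), (∀ S : ℕ, ((∀ o : Option ({p : Fin 4 × Fin 4 // p.1 < p.2} → ↥π.ker), MeasurableSet ((cls S) ⁻¹'
    {o})) ∧ (∀ V : Literature.MathematicalPhysics.QuantumFieldTheory.GaugeConfig 4 (2 * S + 1) H, (cls S) V = none ↔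
    (S < 64 ∨ ∃ (k : ℕ) (ch : Fin (k + 1) → Literature.MathematicalPhysics.QuantumFieldTheory.Plaquette 4 (2 * S +
    1)), (∀ i, a ≤ (r.N : ℝ) - ((r.ρ.comp π) (Literature.MathematicalPhysics.QuantumFieldTheory.plaquetteHolonomy V
    (ch i).1 (ch i).2.1.1 (ch i).2.1.2)).trace.re) ∧ (∀ i : Fin k, (Finset.univ.sup fun j : Fin 4 => (((ch
    i.castSucc).1 j - (ch i.succ).1 j).valMinAbs).natAbs) ≤ 3) ∧ S ≤ 16 * (Finset.univ.sup fun j : Fin 4 => (((ch 0).1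
    j - (ch (Fin.last k)).1 j).valMinAbs).natAbs))) ∧ (∀ (ε : Literature.MathematicalPhysics.QuantumFieldTheory.Edge 4
    (2 * S + 1) → ↥π.ker) (V : Literature.MathematicalPhysics.QuantumFieldTheory.GaugeConfig 4 (2 * S + 1) H), (cls S)
    (fun e => ((ε e : ↥π.ker) : H) * V e) = (cls S) V) ∧ (∀ (g :
    Literature.MathematicalPhysics.QuantumFieldTheory.Site 4 (2 * S + 1) → H) (V :
    Literature.MathematicalPhysics.QuantumFieldTheory.GaugeConfig 4 (2 * S + 1) H), (cls S)
    (Literature.MathematicalPhysics.QuantumFieldTheory.gaugeTransform g V) = (cls S) V) ∧ (∀ (v :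
    Literature.MathematicalPhysics.QuantumFieldTheory.Site 4 (2 * S + 1)) (V :
    Literature.MathematicalPhysics.QuantumFieldTheory.GaugeConfig 4 (2 * S + 1) H), (cls S) (fun e => V (e.1 + v,
    e.2)) = (cls S) V) ∧ (∀ (V V' : Literature.MathematicalPhysics.QuantumFieldTheory.GaugeConfig 4 (2 * S + 1) H) (x₀
    : Literature.MathematicalPhysics.QuantumFieldTheory.Site 4 (2 * S + 1)), (∀ e :
    Literature.MathematicalPhysics.QuantumFieldTheory.Edge 4 (2 * S + 1), S < 16 * (Finset.univ.sup fun j : Fin 4 =>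
    ((e.1 j - x₀ j).valMinAbs).natAbs) → V e = V' e) → (cls S) V ≠ none → (cls S) V' ≠ none → (cls S) V = (cls S) V')
    ∧ (∀ (z : {p : Fin 4 × Fin 4 // p.1 < p.2} → ↥π.ker) (ε : Literature.MathematicalPhysics.QuantumFieldTheory.Edge 4
    (2 * S + 1) → ↥π.ker) (V : Literature.MathematicalPhysics.QuantumFieldTheory.GaugeConfig 4 (2 * S + 1) H), (∀ p :
    Literature.MathematicalPhysics.QuantumFieldTheory.Plaquette 4 (2 * S + 1), (∀ k' : H, k' ∈ π.ker → k' ≠ ((if p.1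
    p.2.1.1 = 0 ∧ p.1 p.2.1.2 = 0 then ((z p.2 : ↥π.ker) : H) else (1 : H)) *
    Literature.MathematicalPhysics.QuantumFieldTheory.plaquetteHolonomy (fun e => ((ε e : ↥π.ker) : H)) p.1 p.2.1.1
    p.2.1.2) → (ρH.ρ (k'⁻¹ * Literature.MathematicalPhysics.QuantumFieldTheory.plaquetteHolonomy V p.1 p.2.1.1
    p.2.1.2)).trace.re < (ρH.ρ ((((if p.1 p.2.1.1 = 0 ∧ p.1 p.2.1.2 = 0 then ((z p.2 : ↥π.ker) : H) else (1 : H)) *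
    Literature.MathematicalPhysics.QuantumFieldTheory.plaquetteHolonomy (fun e => ((ε e : ↥π.ker) : H)) p.1 p.2.1.1
    p.2.1.2))⁻¹ * Literature.MathematicalPhysics.QuantumFieldTheory.plaquetteHolonomy V p.1 p.2.1.1
    p.2.1.2)).trace.re)) → (cls S) V = none ∨ (cls S) V = some z) ∧ (∀ q : {p : Fin 4 × Fin 4 // p.1 < p.2}, q.1.1 ≠ 0
    → ∃ (σ : Equiv.Perm (Fin 4)) (Ψ : ({p : Fin 4 × Fin 4 // p.1 < p.2} → ↥π.ker) → ({p : Fin 4 × Fin 4 // p.1 < p.2}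
    → ↥π.ker)), Function.Injective Ψ ∧ (∀ V : Literature.MathematicalPhysics.QuantumFieldTheory.GaugeConfig 4 (2 * S +
    1) H, (cls S) (Literature.MathematicalPhysics.QuantumFieldTheory.configPerm σ V) = ((cls S) V).map Ψ) ∧ (∀ z w :
    {p : Fin 4 × Fin 4 // p.1 < p.2} → ↥π.ker, (∀ q' : {p : Fin 4 × Fin 4 // p.1 < p.2}, q' ≠ q → z q' = w q') → ∀ q''
    : {p : Fin 4 × Fin 4 // p.1 < p.2}, q''.1.1 ≠ 0 → Ψ z q'' = Ψ w q'')))) → ∀ c : ℝ, 0 < c → ∃ β_p : ℝ, ∀ β : ℝ, β_p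
    ≤ β → (∃ w : H → ℝ, Continuous w ∧ (∀ h, 0 ≤ w h) ∧ (∀ h, w h⁻¹ = w h) ∧ (∀ g h, w (g * h * g⁻¹) = w h) ∧ (∀ (n :
    ℕ) (x : Fin n → H) (v : Fin n → ℂ), 0 ≤ (∑ i, ∑ j, (starRingEnd ℂ) (v i) * v j * ((w ((x i)⁻¹ * x j) : ℝ) :
    ℂ)).re) ∧ (∀ h, ∑ᶠ k ∈ (π.ker : Set H), w (k * h) = Real.exp (β * (r.ρ (π h)).trace.re)) ∧ (∫ h in {h : H | (∀ k'
    : H, k' ∈ π.ker → k' ≠ 1 → (ρH.ρ (k'⁻¹ * h)).trace.re < (ρH.ρ h).trace.re)}, (Real.exp (β * (r.ρ (π h)).trace.re) -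
    w h) ∂(Literature.MathematicalPhysics.QuantumFieldTheory.haarProbability H) ≤ Real.exp (-(c * β)) * ∫ h, w h
    ∂(Literature.MathematicalPhysics.QuantumFieldTheory.haarProbability H))) → (∃ μ : ℝ, 0 < μ ∧ ∃ (S_e : ℕ) (C : ℝ), ∀ (S : ℕ) (z w : {p : Fin 4 × Fin 4 // p.1 < p.2} → ↥π.ker), S_e ≤ S →
    (∀ q : {p : Fin 4 × Fin 4 // p.1 < p.2}, q.1.1 ≠ 0 → z q = w q) → |((Literature.MathematicalPhysics.QuantumFieldTheory.wilsonMeasure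
    (r.ρ.comp π) β : MeasureTheory.Measure (Literature.MathematicalPhysics.QuantumFieldTheory.GaugeConfig 4 (2 * S +
    1) H)) ((cls S) ⁻¹' {some z})).toReal - ((Literature.MathematicalPhysics.QuantumFieldTheory.wilsonMeasure
    (r.ρ.comp π) β : MeasureTheory.Measure (Literature.MathematicalPhysics.QuantumFieldTheory.GaugeConfig 4 (2 * S +
    1) H)) ((cls S) ⁻¹' {some w})).toReal| ≤ C * Real.exp (-(μ * (2 * (S : ℝ) + 1))) *
    ((Literature.MathematicalPhysics.QuantumFieldTheory.wilsonMeasure (r.ρ.comp π) β : MeasureTheory.Measure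
    (Literature.MathematicalPhysics.QuantumFieldTheory.GaugeConfig 4 (2 * S + 1) H)) ((cls S) ⁻¹' {some w})).toReal) →
    (∃ m : ℝ, 0 < m ∧ ∀ A B : Literature.MathematicalPhysics.QuantumFieldTheory.YMSpecies G, ∃ C : ℝ, ∀ (S n : ℕ) (z :
    {p : Fin 4 × Fin 4 // p.1 < p.2} → ↥π.ker), n ≤ S → |(∫ V in ((cls S) ⁻¹' {some z}), A.F (fun e => π
    (Literature.MathematicalPhysics.QuantumLattice.torusLift (2 * S + 1) V e)) * B.F (fun e => π
    (Literature.MathematicalPhysics.QuantumLattice.configShift (-Pi.single 0 (n : ℤ))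
    (Literature.MathematicalPhysics.QuantumLattice.torusLift (2 * S + 1) V) e))
    ∂(Literature.MathematicalPhysics.QuantumFieldTheory.wilsonMeasure (r.ρ.comp π) β : MeasureTheory.Measure
    (Literature.MathematicalPhysics.QuantumFieldTheory.GaugeConfig 4 (2 * S + 1) H))) -
    (((Literature.MathematicalPhysics.QuantumFieldTheory.wilsonMeasure (r.ρ.comp π) β : MeasureTheory.Measure
    (Literature.MathematicalPhysics.QuantumFieldTheory.GaugeConfig 4 (2 * S + 1) H)) ((cls S) ⁻¹' {some z})).toReal)⁻¹
    * (∫ V in ((cls S) ⁻¹' {some z}), A.F (fun e => π (Literature.MathematicalPhysics.QuantumLattice.torusLift (2 * S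
    + 1) V e)) ∂(Literature.MathematicalPhysics.QuantumFieldTheory.wilsonMeasure (r.ρ.comp π) β :
    MeasureTheory.Measure (Literature.MathematicalPhysics.QuantumFieldTheory.GaugeConfig 4 (2 * S + 1) H))) * (∫ V in
    ((cls S) ⁻¹' {some z}), B.F (fun e => π (Literature.MathematicalPhysics.QuantumLattice.configShift (-Pi.single 0
    (n : ℤ)) (Literature.MathematicalPhysics.QuantumLattice.torusLift (2 * S + 1) V) e))
    ∂(Literature.MathematicalPhysics.QuantumFieldTheory.wilsonMeasure (r.ρ.comp π) β : MeasureTheory.Measure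
    (Literature.MathematicalPhysics.QuantumFieldTheory.GaugeConfig 4 (2 * S + 1) H)))| ≤ C * Real.exp (-(m * n)) *
    ((Literature.MathematicalPhysics.QuantumFieldTheory.wilsonMeasure (r.ρ.comp π) β : MeasureTheory.Measure
    (Literature.MathematicalPhysics.QuantumFieldTheory.GaugeConfig 4 (2 * S + 1) H)) ((cls S) ⁻¹' {some z})).toReal) := by
  sorry

/-! ## §2 The composition: the stubs imply the crux, BY NAME -/

/-- **MIX (v2 shape) from the LANDED core `mix_core` (p165422).** The v1 stub `stub_sectorMixture` landed verbatim
(Theorems/ConvexGribovBodyNonSimplyConnectedLatticeGapStubSectorMixture.lean, with Aux1–3 p164497/p164608/p164823);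
v2 weakens its equipartition hypothesis to the tori `S ≥ S_e` (EQUI was reshaped after the wave-1 audit: at small
badness `a` the small tori may have EMPTY electric sectors next to non-empty ones, so no `S`-uniform multiplicative
comparability can hold). Derivation, no new analysis: apply `mix_core` to the modified labelling
`cls' S V := if S_e ≤ S then cls S V else none` — it keeps measurable fibres (X_m), translation invariance (X6) and
axis exchange (X5, same `σ, Ψ`), its unlabelled set below `S_e` is everything (absorbed into the bad-event constant
`max C e^{c S_e}`), every sector hypothesis below `S_e` holds trivially on EMPTY sectors, and the conclusion does
not mention the labelling. -/
theorem sectorMixture_of_core : SectorMixture := by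
  intro G _ _ _ _ _ _ hG H _ _ _ _ _ _ hH hsc π hπc hπs hker hfin hnt ρH r a β cls hI hbad hpsc hequi heblind
  classical
  haveI : Fintype ↥π.ker := @Fintype.ofFinite _ hfin.to_subtype
  have hρc : Continuous (r.ρ.comp π) := r.continuous.comp hπc
  obtain ⟨μ₁, hμ₁, S_e, C₁, hC₁⟩ := hequi
  obtain ⟨c, hc, Cb, hCb⟩ := hbad
  obtain ⟨m, hm, hP⟩ := hpsc
  obtain ⟨μ₂, hμ₂, hE⟩ := heblind
  -- the modified labelling agrees with `cls` from `S_e` on and has empty sectors below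
  have hon : ∀ S : ℕ, S_e ≤ S →
      (fun V : Literature.MathematicalPhysics.QuantumFieldTheory.GaugeConfig 4 (2 * S + 1) H =>
        if S_e ≤ S then cls S V else none) = cls S :=
    fun S hS => funext fun V => if_pos hS
  have hoff : ∀ S : ℕ, ¬ S_e ≤ S → ∀ z : {p : Fin 4 × Fin 4 // p.1 < p.2} → ↥π.ker,
      (fun V : Literature.MathematicalPhysics.QuantumFieldTheory.GaugeConfig 4 (2 * S + 1) H =>
        if S_e ≤ S then cls S V else none) ⁻¹' {some z} = ∅ :=
    fun S hS z => Set.eq_empty_of_forall_notMem fun V hV => by simp [if_neg hS] at hV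
  refine Summit.QuantumFields.YangMills.Theorems.NonSimplyConnectedLatticeGap.mix_core π hπc (r.ρ.comp π) hρc β
    (fun (S : ℕ) (V : Literature.MathematicalPhysics.QuantumFieldTheory.GaugeConfig 4 (2 * S + 1) H) =>
      if S_e ≤ S then cls S V else none)
    (fun S => (Literature.MathematicalPhysics.QuantumFieldTheory.wilsonMeasure (r.ρ.comp π) β :
      MeasureTheory.Measure (Literature.MathematicalPhysics.QuantumFieldTheory.GaugeConfig 4 (2 * S + 1) H)))
    (fun _ => rfl) ?_ ?_ ?_ ?_ ?_ ?_ ?_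
  · -- X_m
    intro S o
    by_cases hS : S_e ≤ S
    · rw [hon S hS]; exact (hI S).1 o
    · simp only [if_neg hS]
      exact MeasurableSet.const _
  · -- X6
    intro S v V
    by_cases hS : S_e ≤ S
    · simp only [if_pos hS]; exact (hI S).2.2.2.2.1 v V
    · simp only [if_neg hS]
  · -- X5
    intro S q hq
    obtain ⟨σ, Ψ, hΨ, hperm, hrel⟩ := (hI S).2.2.2.2.2.2.2 q hq
    refine ⟨σ, Ψ, hΨ, fun V => ?_, hrel⟩
    by_cases hS : S_e ≤ S
    · simp only [if_pos hS]; exact hperm V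
    · simp only [if_neg hS, Option.map_none]
  · -- bad event: below `S_e` everything is unlabelled, absorbed into the constant
    refine ⟨c, hc, max Cb (Real.exp (c * S_e)), fun S => ?_⟩
    by_cases hS : S_e ≤ S
    · rw [hon S hS]
      exact (hCb S).trans (mul_le_mul_of_nonneg_right (le_max_left _ _) (Real.exp_nonneg _))
    · haveI := Literature.MathematicalPhysics.QuantumFieldTheory.isProbabilityMeasure_wilsonMeasure
        (d := 4) (L := 2 * S + 1) (r.ρ.comp π) hρc β
      have h1 : ((Literature.MathematicalPhysics.QuantumFieldTheory.wilsonMeasure (r.ρ.comp π) β :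
          MeasureTheory.Measure (Literature.MathematicalPhysics.QuantumFieldTheory.GaugeConfig 4 (2 * S + 1) H))
          ((fun V : Literature.MathematicalPhysics.QuantumFieldTheory.GaugeConfig 4 (2 * S + 1) H =>
            if S_e ≤ S then cls S V else none) ⁻¹' {none})).toReal ≤ 1 :=
        (ENNReal.toReal_mono ENNReal.one_ne_top MeasureTheory.prob_le_one).trans_eq ENNReal.toReal_one
      have h2 : (1 : ℝ) ≤ Real.exp (c * S_e) * Real.exp (-(c * S)) := by
        rw [← Real.exp_add]
        refine Real.one_le_exp ?_
        have : (S : ℝ) ≤ S_e := by exact_mod_cast (not_le.1 hS).le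
        nlinarith
      exact h1.trans (h2.trans (mul_le_mul_of_nonneg_right (le_max_right _ _) (Real.exp_nonneg _)))
  · -- per-sector clustering: empty sectors below `S_e`
    refine ⟨m, hm, fun A B => ?_⟩
    obtain ⟨C, hC⟩ := hP A B
    refine ⟨C, fun S n z hn => ?_⟩
    by_cases hS : S_e ≤ S
    · rw [hon S hS]; exact hC S n z hn
    · rw [hoff S hS z]; simp
  · -- electric equipartition: given from `S_e` on, trivial on empty sectors below
    refine ⟨μ₁, hμ₁, C₁, fun S z w hzw => ?_⟩
    by_cases hS : S_e ≤ S
    · rw [hon S hS]; exact hC₁ S z w hS hzw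
    · rw [hoff S hS z, hoff S hS w]; simp
  · -- electric blindness
    refine ⟨μ₂, hμ₂, fun A => ?_⟩
    obtain ⟨C, hC⟩ := hE A
    refine ⟨C, fun S z w hzw => ?_⟩
    by_cases hS : S_e ≤ S
    · rw [hon S hS]; exact hC S z w hzw
    · rw [hoff S hS z, hoff S hS w]; simp

/-- **Pure logic: STRUCT-EXIST, bad-event rarity (LANDED `torusBadEventRare`), MIX (proved above), EQUI, SPLIT,
EBLIND, PSC ⇒ `CoverClustering`.** Fix a cover datum; STRUCT-EXIST gives the badness threshold `a` and the labelling
family `cls` with its interface certificate; `torusBadEventRare` (p164029) at this `a`, rewritten through clause X0,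
gives `β_c` and the bad-event bound; SPLIT gives the noise rate `c` and `β_s`; EQUI, EBLIND, PSC give `β_e, β_b,
β_p` for this `(a, cls, c)`; for `β ≥ max` of the five, MIX assembles the clustering body at `β`. (Instantiated
below with the §1 stubs, which certifies that each inline stub signature is definitionally the §0 proposition.) -/
theorem coverClustering_of (h₂ : SectorLabelling) (h₃ : SectorMixture) (h₄ : TwistEquipartition)
    (h₅ : CentreSplitting) (h₆ : ElectricBlindnessOfEquipartition) (h₇ : PerSectorClusteringOfEquipartition) :
    CoverClustering := by
  intro G _ _ _ _ _ _ hG H _ _ _ _ _ _ hH hsc π hπc hπs hker hfin hnt ρH r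
  obtain ⟨a, ha, cls, hI⟩ := h₂ G hG H hH hsc π hπc hπs hker hfin hnt ρH r
  obtain ⟨βc, hrare⟩ := Summit.QuantumFields.YangMills.Theorems.NonSimplyConnectedLatticeGap.torusBadEventRare
    G hG H hH hsc π hπc hπs hker hfin hnt ρH r a ha
  have hbad : ∀ β : ℝ, βc ≤ β → ∃ c : ℝ, 0 < c ∧ ∃ C : ℝ, ∀ S : ℕ,
      ((Literature.MathematicalPhysics.QuantumFieldTheory.wilsonMeasure (r.ρ.comp π) β :
        MeasureTheory.Measure (Literature.MathematicalPhysics.QuantumFieldTheory.GaugeConfig 4 (2 * S + 1) H))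
        ((cls S) ⁻¹' {none})).toReal ≤ C * Real.exp (-(c * S)) := by
    intro β hβ
    obtain ⟨c, hc, C, hC⟩ := hrare β hβ
    refine ⟨c, hc, C, fun S => ?_⟩
    rw [show (cls S) ⁻¹' {none} = _ from Set.ext fun V => (hI S).2.1 V]
    exact hC S
  obtain ⟨c, hc, βs, hsplit⟩ := h₅ G hG H hH hsc π hπc hπs hker hfin hnt ρH r
  obtain ⟨βe, hequi⟩ := h₄ G hG H hH hsc π hπc hπs hker hfin hnt ρH r a cls hI
  obtain ⟨βb, hebl⟩ := h₆ G hG H hH hsc π hπc hπs hker hfin hnt ρH r a cls hI c hc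
  obtain ⟨βp, hpsc⟩ := h₇ G hG H hH hsc π hπc hπs hker hfin hnt ρH r a cls hI c hc
  refine ⟨max (max βc βs) (max βe (max βb βp)), fun β hβ => ?_⟩
  have h1 : max βc βs ≤ β := le_trans (le_max_left _ _) hβ
  have h2 : max βe (max βb βp) ≤ β := le_trans (le_max_right _ _) hβ
  have hβc : βc ≤ β := le_trans (le_max_left _ _) h1
  have hβs : βs ≤ β := le_trans (le_max_right _ _) h1
  have hβe : βe ≤ β := le_trans (le_max_left _ _) h2
  have h3 : max βb βp ≤ β := le_trans (le_max_right _ _) h2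
  have hβb : βb ≤ β := le_trans (le_max_left _ _) h3
  have hβp : βp ≤ β := le_trans (le_max_right _ _) h3
  have hsp := hsplit β hβs
  have heq := hequi β hβe
  exact h₃ G hG H hH hsc π hπc hπs hker hfin hnt ρH r a β cls hI (hbad β hβc) (hpsc β hβp hsp heq) heq
    (hebl β hβb hsp heq)

/-- `CoverClustering` from the five registered sector stubs and the proved MIX (§1 ≡ §0 by `rfl`-unfolding). -/
theorem coverClustering_of_stubs : CoverClustering :=
  coverClustering_of stub_sectorLabelling sectorMixture_of_core stub_twistEquipartition stub_centreSplitting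
    stub_electricBlindness stub_perSectorClustering

/-- **COVER from WEYL (landed reduction `stub_universalCover_of_cover`, p164142).** -/
theorem universalCover_of_weyl : UniversalCover :=
  Summit.QuantumFields.YangMills.Theorems.NonSimplyConnectedLatticeGap.stub_universalCover_of_cover stub_weylCovering

/-- **COVER + `CoverClustering` ⇒ the clustering body of the crux at a fixed `(G, r)`** (pure logic + the landed
pullback). COVER gives the cover datum `(H, π)` (and `ρH` from `IsCompactSimpleLieGroup H`); `CoverClustering` gives
the clustering body for the `(H, r∘π)` theory on pulled-back observables; the landed `stub_corrPullbackCover` (line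
`Sketch`, K1) identifies each pulled-back correlation with the crux's `latticeConnectedCorr r.ρ β (2S+1) A.F B.F n`
(`G` is second countable through the faithful `r`). Stated for a fixed group so that `NonSimplyConnectedLatticeGap_of`
stays the ONLY theorem of this file whose conclusion is the crux decl (A12 audit). -/
theorem clustering_of_cover (h₁ : UniversalCover) (hc : CoverClustering) (G : Type) [Group G] [TopologicalSpace G]
    [IsTopologicalGroup G] [CompactSpace G] [MeasurableSpace G] [BorelSpace G]
    (hG : Literature.MathematicalPhysics.QuantumFieldTheory.IsCompactSimpleLieGroup G) (hnsc : ¬ SimplyConnectedSpace G)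
    (r : Literature.MathematicalPhysics.QuantumFieldTheory.LatticeRep G) :
    ∃ β₀ : ℝ, ∀ β : ℝ, β₀ ≤ β → ∃ m : ℝ, 0 < m ∧ ∃ S₁ : ℕ,
      ∀ A B : Literature.MathematicalPhysics.QuantumFieldTheory.YMSpecies G, ∃ C : ℝ, ∀ S n : ℕ, S₁ ≤ S → n ≤ S →
        |Literature.MathematicalPhysics.QuantumFieldTheory.latticeConnectedCorr r.ρ β (2 * S + 1) A.F B.F n| ≤
          C * Real.exp (-(m * n)) := by
  obtain ⟨H, _, _, _, _, _, _, π, hH, hsc, hπc, hπs, hker, hfin, hnt⟩ := h₁ G hG hnsc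
  obtain ⟨ρH⟩ := hH.2
  obtain ⟨β₀, hβ₀⟩ := hc G hG H hH hsc π hπc hπs hker hfin hnt ρH r
  refine ⟨β₀, fun β hβ => ?_⟩
  obtain ⟨m, hm, S₁, h⟩ := hβ₀ β hβ
  refine ⟨m, hm, S₁, fun A B => ?_⟩
  obtain ⟨C, hC⟩ := h A B
  refine ⟨C, fun S n hS hn => ?_⟩
  haveI : SecondCountableTopology G :=
    (r.continuous.isClosedEmbedding r.injective).isEmbedding.secondCountableTopology
  rw [← Summit.QuantumFields.YangMills.Theorems.NonSimplyConnectedLatticeGap.stub_corrPullbackCover G H π hπc hπs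
    r.N r.ρ r.continuous β (2 * S + 1) A.F B.F A.measurable B.measurable n]
  exact hC S n hS hn

/-- **The skeleton theorem (A12 shape): the crux decl BY NAME, no hypotheses, `sorry` entering only through the
six registered `stub_*`** — WEYL (`stub_weylCovering`, giving COVER through the landed reduction) and the cover-side
clustering assembled from the five sector stubs and the proved MIX (`coverClustering_of_stubs`), glued by
`clustering_of_cover`. -/
theorem NonSimplyConnectedLatticeGap_of :
    Summit.QuantumFields.YangMills.Theses.ConvexGribovBody.NonSimplyConnectedLatticeGap :=
  fun G _ _ _ _ _ _ hG hnsc r => clustering_of_cover universalCover_of_weyl coverClustering_of_stubs G hG hnsc r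

/-! ## §3 Sanity (landed facts in this file's shapes; non-vacuity; nothing asserted) -/

/-- The landed pullback identity in the shape of this file's observables: the `H`-side connected correlation of
the pulled-back observables IS the crux's `latticeConnectedCorr`. -/
example (G H : Type) [Group G] [TopologicalSpace G] [IsTopologicalGroup G] [CompactSpace G] [MeasurableSpace G]
    [BorelSpace G] [SecondCountableTopology G] [Group H] [TopologicalSpace H] [IsTopologicalGroup H]
    [CompactSpace H] [MeasurableSpace H] [BorelSpace H] (π : H →* G) (hπ : Continuous π)
    (hs : Function.Surjective π) (r : Literature.MathematicalPhysics.QuantumFieldTheory.LatticeRep G)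
    (β : ℝ) (S n : ℕ) (A B : Literature.MathematicalPhysics.QuantumFieldTheory.YMSpecies G) :
    Literature.MathematicalPhysics.QuantumFieldTheory.latticeConnectedCorr (r.ρ.comp π) β (2 * S + 1)
        (fun V => A.F (fun e => π (V e))) (fun V => B.F (fun e => π (V e))) n =
      Literature.MathematicalPhysics.QuantumFieldTheory.latticeConnectedCorr r.ρ β (2 * S + 1) A.F B.F n :=
  Summit.QuantumFields.YangMills.Theorems.NonSimplyConnectedLatticeGap.stub_corrPullbackCover G H π hπ hs r.N r.ρ
    r.continuous β (2 * S + 1) A.F B.F A.measurable B.measurable n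

section NonVacuity

open Literature.MathematicalPhysics.QuantumFieldTheory Literature.MathematicalPhysics.QuantumLattice
open Literature.AlgebraicTopology.FundamentalGroup
open Summit.QuantumFields.YangMills.Theorems.NonSimplyConnectedLatticeGap

/-- The unit quaternions carry a faithful continuous unitary matrix representation (through the landed
`S³ ≃* SU(2)`, `stub_sphere_mulEquiv_su2`, and the fundamental representation). [folklore] -/
theorem nonempty_latticeRep_sphere : Nonempty (LatticeRep (Metric.sphere (0 : Quaternion ℝ) 1)) := by
  obtain ⟨e, he, -, -⟩ := stub_sphere_mulEquiv_su2
  refine ⟨⟨2, (fundamentalRep (Fin 2)).comp e.toMonoidHom, ?_, ?_, ?_⟩⟩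
  · exact (continuous_fundamentalRep (Fin 2)).comp he
  · exact (fundamentalRep_injective (Fin 2)).comp e.injective
  · intro g; exact fundamentalRep_mem_unitaryGroup _

/-- **NON-VACUITY: the cover context of this line is inhabited** — `G = SO(3)`, `H = S³` (unit quaternions),
`π = rotHom`: `G` compact simple Lie and NOT simply connected (`so3_admissible`), `H` compact simple Lie
(`isSimpleCompactGroup_sphere` + `nonempty_latticeRep_sphere`) and simply connected
(`simplyConnectedSpace_sphere_quaternion`), `π` a continuous surjective homomorphism with kernel `{±1}` — central,
finite, non-trivial. So the `∀`-stubs STRUCT/MIX/EQUI/SPLIT/EBLIND/PSC speak about a non-empty class, and COVER's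
hypothesis `CoverClustering` has at least this instance to deliver. [cite: HatcherAT2002, §3.D] -/
theorem coverContext_inhabited :
    ∃ (G : Type) (_ : Group G) (_ : TopologicalSpace G) (_ : IsTopologicalGroup G) (_ : CompactSpace G)
      (_ : MeasurableSpace G) (_ : BorelSpace G) (H : Type) (_ : Group H) (_ : TopologicalSpace H)
      (_ : IsTopologicalGroup H) (_ : CompactSpace H) (_ : MeasurableSpace H) (_ : BorelSpace H) (π : H →* G),
      IsCompactSimpleLieGroup G ∧ ¬ SimplyConnectedSpace G ∧ IsCompactSimpleLieGroup H ∧ SimplyConnectedSpace H ∧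
      Continuous π ∧ Function.Surjective π ∧ π.ker ≤ Subgroup.center H ∧ (π.ker : Set H).Finite ∧ π.ker ≠ ⊥ ∧
      Nonempty (LatticeRep H) ∧ Nonempty (LatticeRep G) := by
  obtain ⟨iT, iC, hG, hnsc⟩ := so3_admissible
  letI : MeasurableSpace SO3 := borel SO3
  haveI : BorelSpace SO3 := ⟨rfl⟩
  letI : MeasurableSpace (Metric.sphere (0 : Quaternion ℝ) 1) := borel _
  haveI : BorelSpace (Metric.sphere (0 : Quaternion ℝ) 1) := ⟨rfl⟩
  refine ⟨SO3, inferInstance, inferInstance, iT, iC, inferInstance, inferInstance,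
    Metric.sphere (0 : Quaternion ℝ) 1, inferInstance, inferInstance, inferInstance, inferInstance, inferInstance,
    inferInstance, rotHom, hG, hnsc, ⟨isSimpleCompactGroup_sphere, nonempty_latticeRep_sphere⟩, inferInstance,
    continuous_rotHom, surjective_rotHom, ?_, ?_, ?_, nonempty_latticeRep_sphere, hG.2⟩
  · intro q hq
    rw [Subgroup.mem_center_iff]
    intro g
    rcases (mem_ker_rotHom_iff q).1 hq with h1 | h1
    · rw [h1, mul_one, one_mul]
    · rw [h1, mul_neg_one, neg_one_mul]
  · rw [coe_ker_rotHom]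
    exact Set.toFinite _
  · intro h
    have hm : (-1 : Metric.sphere (0 : Quaternion ℝ) 1) ∈ rotHom.ker := (mem_ker_rotHom_iff _).2 (Or.inr rfl)
    rw [h, Subgroup.mem_bot] at hm
    exact one_ne_neg_one_sphere hm.symm

end NonVacuity

end Summit.QuantumFields.YangMills.Cruxes.NonSimplyConnectedLatticeGap.TwistEquipartitionBlindness

end
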